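import Literature.Computability.FineGrained.SparsifierMain
import Literature.Computability.FineGrained.Sparsification
import HarnessLib

/-!
# The sparsification lemma of Impagliazzo–Paturi–Zane: the algorithm, and the named fact proved

Family `fine-grained` (trunk T-CPLX-FINE). This file identifies the list-level model of the
stack program `Sparsifier.main` (`SparsifierMain.lean`) with the recursion tree
`Sparsification.run` of the algorithm `Reduce` analysed in `Sparsification.lean`
(Impagliazzo–Paturi–Zane, JCSS 63 (2001), §2), and proves the named fact
`Literature.Computability.FineGrained.sparsification` (**fine-grained.S05**; Theorem 1 and Corollary 1 of the source,
*including* the time bound `2^{εn} · poly(L)` on a multi-stack Turing machine):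

* shadows: a clause (a list of literals with indices `< n`) is read as its literal set
  `KCNF.litSet n`, a list of clauses as the finset of these (`shF`);
* `thetaL_spec` — the online `Θ` of the program enumerates, without repetition of literal sets,
  the antichain `Sparsification.minimals` of the family;
* `findBranch` is a valid selection rule: a find is a qualifying weak sunflower, first in the
  loop order (`qual_br`, `lexMin_br`), and no find means no qualifying sunflower
  (`not_qual_of_findBranch_none`); with the position oracle `famAt` this gives a
  position-dependent rule `stepO` with `∀ p, IsValidStep θ (stepO p)`;
* `map_cur_run_eq` — along this rule the leaves of `Sparsification.run` are the shadows of the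
  leaves of the model tree `treeL`, so that Lemmas 1, 2, 7 and the termination of the source
  transfer to the program: number of leaves `≤ 2^{εn/2}`, leaves of `≤ C · n` clauses, same
  satisfying assignments, and the depth-first traversal ends within twice as many iterations;
* `sparsification_holds : sparsification` — with `F φ` the list of leaf formulas, the time
  bound `T n L = ⌊c · 2^{εn} · (L + 1)^c⌋₊` and the machine of `ACom.exists_computesInTime`.

## References

* R. Impagliazzo, R. Paturi, F. Zane, *Which problems have strongly exponential complexity?*,
  J. Comput. Syst. Sci. 63 (2001) 512–530, §2, Theorem 1, Corollary 1, Lemmas 1–7.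
-/

namespace Literature.Computability.FineGrained

open _root_.Computability Finset Sparsification Sparsifier

namespace Sparsifier

/-! ### Shadows of clauses and families -/

/-- Well-formed clauses on `n` variables: all variable indices are `< n`. [folklore] -/
def IdxLt (n : ℕ) (c : List Lit) : Prop := ∀ l ∈ c, l.1 < n

/-- The shadow of a list of clauses: the finset of their literal sets.
[cite: ImpagliazzoPaturiZaneJCSS2001, §2 (k-SAT as k-Set Cover)] -/
def shF (n : ℕ) (F : List (List Lit)) : Finset (Finset (Fin n × Bool)) :=
  (F.map (KCNF.litSet n)).toFinset

/-- Membership in a literal set. [folklore] -/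
theorem mem_litSet_iff {n : ℕ} {c : List Lit} {a : Fin n × Bool} :
    a ∈ KCNF.litSet n c ↔ ((a.1 : ℕ), a.2) ∈ c := by
  simp [KCNF.litSet]

/-- Inclusion of literal sets is inclusion of well-formed clauses. [folklore] -/
theorem litSet_subset_iff {n : ℕ} {d c : List Lit} (hd : IdxLt n d) :
    KCNF.litSet n d ⊆ KCNF.litSet n c ↔ d ⊆ c := by
  constructor
  · intro h l hl
    have := h (mem_litSet_iff.2 (by simpa using hl) : ((⟨l.1, hd l hl⟩ : Fin n), l.2) ∈ _)
    simpa [mem_litSet_iff] using this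
  · intro h a ha
    exact mem_litSet_iff.2 (h (mem_litSet_iff.1 ha))

/-- Equality of literal sets of well-formed clauses. [folklore] -/
theorem litSet_eq_iff {n : ℕ} {d c : List Lit} (hd : IdxLt n d) (hc : IdxLt n c) :
    KCNF.litSet n d = KCNF.litSet n c ↔ d ⊆ c ∧ c ⊆ d := by
  rw [le_antisymm_iff]
  exact and_congr (litSet_subset_iff hd) (litSet_subset_iff hc)

/-- The literal set of `l :: c`. [folklore] -/
theorem litSet_cons {n : ℕ} (l : Lit) (hl : l.1 < n) (c : List Lit) :
    KCNF.litSet n (l :: c) = insert ((⟨l.1, hl⟩ : Fin n), l.2) (KCNF.litSet n c) := by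
  ext a
  simp [mem_litSet_iff, Prod.ext_iff, Fin.ext_iff]

/-- The literal set of a well-formed clause without repetitions has as many elements as the
clause. [folklore] -/
theorem card_litSet {n : ℕ} : ∀ {c : List Lit}, IdxLt n c → c.Nodup → (KCNF.litSet n c).card =
    c.length
  | [], _, _ => by simp [KCNF.litSet]
  | l :: c, hc, hnd => by
    have hl := hc l List.mem_cons_self
    have hc' : IdxLt n c := fun l' h => hc l' (List.mem_cons_of_mem _ h)
    rw [List.nodup_cons] at hnd
    rw [litSet_cons l hl, Finset.card_insert_of_notMem, card_litSet hc' hnd.2, List.length_cons]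
    rw [mem_litSet_iff]; exact hnd.1

/-- The literal set of a well-formed clause is empty iff the clause is. [folklore] -/
theorem litSet_eq_empty_iff {n : ℕ} {c : List Lit} (hc : IdxLt n c) : KCNF.litSet n c = ∅ ↔ c =
    [] := by
  constructor
  · intro h
    cases c with
    | nil => rfl
    | cons l c =>
      have : ((⟨l.1, hc l List.mem_cons_self⟩ : Fin n), l.2) ∈ KCNF.litSet n (l :: c) :=
        mem_litSet_iff.2 (by simp)
      rw [h] at this; exact absurd this (Finset.notMem_empty _)
  · rintro rfl; simp [KCNF.litSet]

/-- Literal set of a filtered clause. [folklore] -/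
theorem litSet_filter_notMem {n : ℕ} (t H : List Lit) :
    KCNF.litSet n (t.filter fun l => l ∉ H) = KCNF.litSet n t \ KCNF.litSet n H := by
  ext a
  simp [mem_litSet_iff, Finset.mem_sdiff, List.mem_filter]

/-- Membership in a shadow. [folklore] -/
theorem mem_shF {n : ℕ} {F : List (List Lit)} {s : Finset (Fin n × Bool)} :
    s ∈ shF n F ↔ ∃ c ∈ F, KCNF.litSet n c = s := by
  simp [shF]

/-- Shadow of a concatenation. [folklore] -/
theorem shF_append {n : ℕ} (F G : List (List Lit)) : shF n (F ++ G) = shF n F ∪ shF n G := by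
  simp [shF, List.toFinset_append]

/-- Shadow of a singleton. [folklore] -/
theorem shF_singleton {n : ℕ} (c : List Lit) : shF n [c] = {KCNF.litSet n c} := by
  simp [shF]

/-- Shadow of the empty family. [folklore] -/
@[simp] theorem shF_nil {n : ℕ} : shF n [] = ∅ := by simp [shF]

/-- The set-cover instance of a k-CNF is the shadow of its clauses. [folklore] -/
theorem family_eq_shF {k : ℕ} (φ : KCNF k) : φ.family = shF φ.numVars φ.clauses := rfl

/-! ### The online Θ enumerates the minimal members -/

/-- The invariant of the online computation of `Θ` after the prefix `P`: the kept clauses come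
from `P`, form an antichain without repetitions, lie below every processed clause, and are
minimal among the processed clauses. [folklore] -/
structure ThInv (P acc : List (List Lit)) : Prop where
  mem : ∀ d ∈ acc, d ∈ P
  anti : acc.Pairwise fun d d' => ¬ d ⊆ d' ∧ ¬ d' ⊆ d
  below : ∀ p ∈ P, ∃ d ∈ acc, d ⊆ p
  minimal : ∀ d ∈ acc, ∀ p ∈ P, p ⊆ d → d ⊆ p

/-- The invariant holds initially. [folklore] -/
theorem thInv_nil : ThInv [] [] := ⟨by simp, List.Pairwise.nil, by simp, by simp⟩

/-- In an antichain list, comparable members are equal. [folklore] -/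
theorem eq_of_subset_of_pairwise {acc : List (List Lit)}
    (h : acc.Pairwise fun d d' => ¬ d ⊆ d' ∧ ¬ d' ⊆ d) :
    ∀ d ∈ acc, ∀ d' ∈ acc, d ⊆ d' → d = d' := by
  induction h with
  | nil => simp
  | @cons a l hal _ ih =>
    intro d hd d' hd' hdd
    rw [List.mem_cons] at hd hd'
    rcases hd with rfl | hd <;> rcases hd' with rfl | hd'
    · rfl
    · exact absurd hdd (hal d' hd').1
    · exact absurd hdd (hal d hd).2
    · exact ih d hd d' hd' hdd

/-- Two kept clauses one below the other are equal. [folklore] -/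
theorem ThInv.eq_of_subset {P acc : List (List Lit)} (h : ThInv P acc) {d d' : List Lit}
    (hd : d ∈ acc) (hd' : d' ∈ acc) (hdd : d ⊆ d') : d = d' :=
  eq_of_subset_of_pairwise h.anti d hd d' hd' hdd

/-- The invariant is preserved by one online step. [folklore] -/
theorem ThInv.step {P acc : List (List Lit)} (h : ThInv P acc) (c : List Lit) :
    ThInv (P ++ [c]) (thetaStep acc c) := by
  unfold thetaStep
  by_cases hex : ∃ d ∈ acc, d ⊆ c
  · rw [if_pos hex]
    obtain ⟨d₀, hd₀, hd₀c⟩ := hex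
    refine ⟨fun d hd => List.mem_append_left _ (h.mem d hd), h.anti, ?_, ?_⟩
    · intro p hp
      rw [List.mem_append, List.mem_singleton] at hp
      rcases hp with hp | rfl
      · exact h.below p hp
      · exact ⟨d₀, hd₀, hd₀c⟩
    · intro d hd p hp hpd
      rw [List.mem_append, List.mem_singleton] at hp
      rcases hp with hp | rfl
      · exact h.minimal d hd p hp hpd
      · have := h.eq_of_subset hd₀ hd (List.Subset.trans hd₀c hpd)
        subst this
        exact hd₀c
  · rw [if_neg hex]
    simp only [not_exists, not_and] at hex
    refine ⟨?_, ?_, ?_, ?_⟩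
    · intro d hd
      rw [List.mem_append, List.mem_singleton] at hd ⊢
      rcases hd with hd | rfl
      · exact Or.inl (h.mem d (List.mem_of_mem_filter hd))
      · exact Or.inr rfl
    · rw [List.pairwise_append]
      refine ⟨h.anti.filter _, List.pairwise_singleton _ _, ?_⟩
      intro d hd c' hc'
      rw [List.mem_singleton] at hc'
      subst hc'
      rw [List.mem_filter] at hd
      exact ⟨hex d hd.1, by simpa using hd.2⟩
    · intro p hp
      rw [List.mem_append, List.mem_singleton] at hp
      rcases hp with hp | rfl
      · obtain ⟨d, hd, hdp⟩ := h.below p hp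
        by_cases hcd : c ⊆ d
        · exact ⟨c, by simp, List.Subset.trans hcd hdp⟩
        · exact ⟨d, List.mem_append_left _ (List.mem_filter.2 ⟨hd, by simpa using hcd⟩), hdp⟩
      · exact ⟨p, by simp, List.Subset.refl _⟩
    · intro d hd p hp hpd
      rw [List.mem_append, List.mem_singleton] at hd hp
      rcases hd with hd | rfl
      · rw [List.mem_filter] at hd
        rcases hp with hp | rfl
        · exact h.minimal d hd.1 p hp hpd
        · exact absurd hpd (by simpa using hd.2)
      · rcases hp with hp | rfl
        · obtain ⟨d', hd', hd'p⟩ := h.below p hp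
          exact absurd (List.Subset.trans hd'p hpd) (hex d' hd')
        · exact List.Subset.refl _

/-- The invariant after a whole list. [folklore] -/
theorem thInv_foldl : ∀ (F P acc : List (List Lit)), ThInv P acc →
    ThInv (P ++ F) (F.foldl thetaStep acc)
  | [], P, acc, h => by simpa using h
  | c :: F, P, acc, h => by
    have := thInv_foldl F (P ++ [c]) (thetaStep acc c) (h.step c)
    simpa using this

/-- The invariant of `thetaL F` relative to `F`. [cite: ImpagliazzoPaturiZaneJCSS2001, §2 (the
    operator Θ)] -/
theorem thInv_thetaL (F : List (List Lit)) : ThInv F (thetaL F) := by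
  simpa [thetaL] using thInv_foldl F [] [] thInv_nil

/-- `thetaL F` has no repetition. [folklore] -/
theorem nodup_thetaL (F : List (List Lit)) : (thetaL F).Nodup :=
  (thInv_thetaL F).anti.imp fun {d d'} h hdd => h.1 (by rw [hdd]; exact List.Subset.refl _)

/-- Literal sets do not repeat along `thetaL F` (for well-formed clauses). [folklore] -/
theorem nodup_map_litSet_thetaL {n : ℕ} (F : List (List Lit)) (hF : ∀ c ∈ F, IdxLt n c) :
    ((thetaL F).map (KCNF.litSet n)).Nodup := by
  have h := thInv_thetaL F
  refine List.Nodup.map_on (fun d hd d' hd' hdd => ?_) (nodup_thetaL F)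
  have hsub := ((litSet_eq_iff (hF d (h.mem d hd)) (hF d' (h.mem d' hd'))).1 hdd).1
  exact h.eq_of_subset hd hd' hsub

/-- **`thetaL F` enumerates the minimal literal sets of `F`.**
[cite: ImpagliazzoPaturiZaneJCSS2001, §2 (the operator Θ)] -/
theorem shF_thetaL {n : ℕ} (F : List (List Lit)) (hF : ∀ c ∈ F, IdxLt n c) :
    shF n (thetaL F) = minimals (shF n F) := by
  have h := thInv_thetaL F
  ext s
  rw [mem_shF, mem_minimals]
  constructor
  · rintro ⟨d, hd, rfl⟩
    have hdF := h.mem d hd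
    refine ⟨mem_shF.2 ⟨d, hdF, rfl⟩, fun t ht hts => ?_⟩
    obtain ⟨p, hp, rfl⟩ := mem_shF.1 ht
    have hpd : p ⊆ d := (litSet_subset_iff (hF p hp)).1 hts
    exact le_antisymm hts ((litSet_subset_iff (hF d hdF)).2 (h.minimal d hd p hp hpd))
  · rintro ⟨hs, hmin⟩
    obtain ⟨p, hp, rfl⟩ := mem_shF.1 hs
    obtain ⟨d, hd, hdp⟩ := h.below p hp
    have hdF := h.mem d hd
    have := hmin _ (mem_shF.2 ⟨d, hdF, rfl⟩) ((litSet_subset_iff (hF d hdF)).2 hdp)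
    exact ⟨d, hd, this⟩

/-- The length of `thetaL F` is the number of minimal literal sets. [folklore] -/
theorem length_thetaL_eq_card {n : ℕ} (F : List (List Lit)) (hF : ∀ c ∈ F, IdxLt n c) :
    (thetaL F).length = (minimals (shF n F)).card := by
  rw [← shF_thetaL F hF, shF, List.card_toFinset, List.dedup_eq_self.2 (nodup_map_litSet_thetaL F
      hF),
    List.length_map]

/-! ### Well-formed families -/

/-- Well-formed families of clauses on `n` variables of width `k`: every clause is a list of
distinct literals with indices `< n`, of length at most `k`. [folklore] -/
structure WF (n k : ℕ) (F : List (List Lit)) : Prop where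
  idx : ∀ c ∈ F, IdxLt n c
  nodup : ∀ c ∈ F, c.Nodup
  len : ∀ c ∈ F, c.length ≤ k

/-- Sub-families are well-formed. [folklore] -/
theorem WF.of_subset {n k : ℕ} {F G : List (List Lit)} (h : WF n k F) (hG : ∀ c ∈ G, c ∈ F) :
    WF n k G :=
  ⟨fun c hc => h.idx c (hG c hc), fun c hc => h.nodup c (hG c hc), fun c hc => h.len c (hG c hc)⟩

/-- `Θ` keeps well-formedness. [folklore] -/
theorem WF.thetaL {n k : ℕ} {F : List (List Lit)} (h : WF n k F) : WF n k (thetaL F) :=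
  h.of_subset fun _ hc => mem_of_mem_thetaL hc

/-- Sub-lists of a clause of a well-formed family are well-formed clauses. [folklore] -/
theorem WF.sublist {n k : ℕ} {F : List (List Lit)} (h : WF n k F) {c d : List Lit} (hc : c ∈ F)
    (hd : d.Sublist c) : IdxLt n d ∧ d.Nodup ∧ d.length ≤ k :=
  ⟨fun l hl => h.idx c hc l (hd.subset hl), (h.nodup c hc).sublist hd, hd.length_le.trans (h.len
      c hc)⟩

/-- Members of the shadow of a well-formed family have at most `k` elements. [folklore] -/
theorem WF.card_le {n k : ℕ} {F : List (List Lit)} (h : WF n k F) {s : Finset (Fin n × Bool)}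
    (hs : s ∈ shF n F) : s.card ≤ k := by
  obtain ⟨c, hc, rfl⟩ := mem_shF.1 hs
  rw [card_litSet (h.idx c hc) (h.nodup c hc)]; exact h.len c hc

/-! ### Counting the clauses of the sunflower -/

/-- The sets of the sunflower with heart `H` among the sets of size `j`, abstractly.
[cite: ImpagliazzoPaturiZaneJCSS2001, §2 (weak sunflower)] -/
def Wset (n j : ℕ) (H : List Lit) (M : List (List Lit)) : Finset (Finset (Fin n × Bool)) :=
  (shF n M).filter fun t => t.card = j ∧ KCNF.litSet n H ⊆ t

/-- **The program's count is the size of the abstract sunflower** (for `Θ`-reduced well-formed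
families). [folklore] -/
theorem cntT_eq_card_Wset {n k : ℕ} (j : ℕ) (H : List Lit) (hH : IdxLt n H) (F : List (List Lit))
    (hF : WF n k F) : cntT j H (thetaL F) = (Wset n j H (thetaL F)).card := by
  set M := thetaL F with hM
  have hWF : WF n k M := hF.thetaL
  have hnd : ((M.filter (selT j H)).map (KCNF.litSet n)).Nodup :=
    (nodup_map_litSet_thetaL F hF.idx).sublist ((List.filter_sublist).map _)
  have hset : ((M.filter (selT j H)).map (KCNF.litSet n)).toFinset = Wset n j H M := by
    ext t
    simp only [List.mem_toFinset, List.mem_map, List.mem_filter, decide_eq_true_eq, Wset,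
      Finset.mem_filter, mem_shF]
    constructor
    · rintro ⟨c, ⟨hc, hsel⟩, rfl⟩
      refine ⟨⟨c, hc, rfl⟩, ?_, (litSet_subset_iff hH).2 hsel.2⟩
      rw [card_litSet (hWF.idx c hc) (hWF.nodup c hc)]; exact hsel.1
    · rintro ⟨⟨c, hc, rfl⟩, hcard, hsub⟩
      refine ⟨c, ⟨hc, ?_, (litSet_subset_iff hH).1 hsub⟩, rfl⟩
      rw [card_litSet (hWF.idx c hc) (hWF.nodup c hc)] at hcard; exact hcard
  rw [cntT, List.countP_eq_length_filter, ← hset, List.toFinset_card_of_nodup hnd, List.length_map]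

/-- The abstract sunflower lies in the shadow. [folklore] -/
theorem Wset_subset (n j : ℕ) (H : List Lit) (M : List (List Lit)) : Wset n j H M ⊆ shF n M :=
  Finset.filter_subset _ _

/-! ### What the scan finds -/

/-- A successful `firstMask`. [folklore] -/
theorem firstMask_eq_some {θi : ℕ} {M : List (List Lit)} {j : ℕ} {s : List Lit} :
    ∀ {μs : List (List Bool)} {H : List Lit}, firstMask θi M j s μs = some H →
      ∃ μ ∈ μs, H = pick μ s ∧ θi ≤ cntT j H M
  | [], H, h => by simp [firstMask] at h
  | μ :: μs, H, h => by
    rw [firstMask] at h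
    split_ifs at h with hθ
    · rw [Option.some.injEq] at h
      exact ⟨μ, List.mem_cons_self, h.symm, h ▸ hθ⟩
    · obtain ⟨μ', hμ', h1, h2⟩ := firstMask_eq_some h
      exact ⟨μ', List.mem_cons_of_mem _ hμ', h1, h2⟩

/-- An unsuccessful `firstMask`. [folklore] -/
theorem firstMask_eq_none {θi : ℕ} {M : List (List Lit)} {j : ℕ} {s : List Lit} :
    ∀ {μs : List (List Bool)}, firstMask θi M j s μs = none → ∀ μ ∈ μs, cntT j (pick μ s) M < θi
  | [], _ => by simp
  | μ :: μs, h => by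
    rw [firstMask] at h
    split_ifs at h with hθ
    intro μ' hμ'
    rw [List.mem_cons] at hμ'
    rcases hμ' with rfl | hμ'
    · exact Nat.lt_of_not_le hθ
    · exact firstMask_eq_none h μ' hμ'

/-- A successful `findS`. [folklore] -/
theorem findS_eq_some {θi : ℕ} {M : List (List Lit)} {j h : ℕ} :
    ∀ {ss : List (List Lit)} {H : List Lit}, findS θi M j h ss = some H →
      ∃ s ∈ ss, s.length = j ∧ ∃ μ ∈ masks j h, H = pick μ s ∧ θi ≤ cntT j H M
  | [], H, hs => by simp [findS] at hs
  | s :: ss, H, hs => by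
    rw [findS] at hs
    cases hq : firstAt θi M j h s with
    | some H' =>
      rw [hq, Option.some.injEq] at hs
      subst hs
      unfold firstAt at hq
      split_ifs at hq with hsj
      obtain ⟨μ, hμ, h1, h2⟩ := firstMask_eq_some hq
      exact ⟨s, List.mem_cons_self, hsj, μ, hμ, h1, h2⟩
    | none =>
      rw [hq] at hs
      obtain ⟨s', hs', h1⟩ := findS_eq_some hs
      exact ⟨s', List.mem_cons_of_mem _ hs', h1⟩

/-- An unsuccessful `findS`. [folklore] -/
theorem findS_eq_none {θi : ℕ} {M : List (List Lit)} {j h : ℕ} :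
    ∀ {ss : List (List Lit)}, findS θi M j h ss = none →
      ∀ s ∈ ss, s.length = j → ∀ μ ∈ masks j h, cntT j (pick μ s) M < θi
  | [], _ => by simp
  | s :: ss, hs => by
    rw [findS] at hs
    cases hq : firstAt θi M j h s with
    | some H' => rw [hq] at hs; exact absurd hs (by simp)
    | none =>
      rw [hq] at hs
      intro s' hs' hlen
      rw [List.mem_cons] at hs'
      rcases hs' with rfl | hs'
      · unfold firstAt at hq
        rw [if_pos hlen] at hq
        exact firstMask_eq_none hq
      · exact findS_eq_none hs s' hs' hlen

/-- A successful `findBranch`: the level found, and the levels before it found nothing.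
[folklore] -/
theorem findBranch_eq_some {θ : ℕ → ℕ} {M : List (List Lit)} :
    ∀ {ls : List (ℕ × ℕ)} {j : ℕ} {H : List Lit}, findBranch θ M ls = some (j, H) →
      ∃ pre i post, ls = pre ++ (j, i) :: post ∧ findLevel θ M j i = some H ∧
        ∀ p ∈ pre, findLevel θ M p.1 p.2 = none
  | [], j, H, h => by simp [findBranch] at h
  | (j', i') :: ls, j, H, h => by
    rw [findBranch] at h
    cases hq : findLevel θ M j' i' with
    | some H' =>
      rw [hq] at h
      simp only [Option.some.injEq, Prod.mk.injEq] at h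
      obtain ⟨rfl, rfl⟩ := h
      exact ⟨[], i', ls, rfl, hq, by simp⟩
    | none =>
      rw [hq] at h
      obtain ⟨pre, i, post, hls, h1, h2⟩ := findBranch_eq_some h
      refine ⟨(j', i') :: pre, i, post, by rw [hls]; rfl, h1, ?_⟩
      intro p hp
      rw [List.mem_cons] at hp
      rcases hp with rfl | hp
      · exact hq
      · exact h2 p hp

/-- An unsuccessful `findBranch`. [folklore] -/
theorem findBranch_eq_none {θ : ℕ → ℕ} {M : List (List Lit)} :
    ∀ {ls : List (ℕ × ℕ)}, findBranch θ M ls = none → ∀ p ∈ ls, findLevel θ M p.1 p.2 = none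
  | [], _ => by simp
  | (j', i') :: ls, h => by
    rw [findBranch] at h
    cases hq : findLevel θ M j' i' with
    | some H' => rw [hq] at h; exact absurd h (by simp)
    | none =>
      rw [hq] at h
      intro p hp
      rw [List.mem_cons] at hp
      rcases hp with rfl | hp
      · exact hq
      · exact findBranch_eq_none h p hp

/-- The loop order on levels. [cite: ImpagliazzoPaturiZaneJCSS2001, §2 (lines 2–3 of Reduce)] -/
def LevLT (p q : ℕ × ℕ) : Prop := p.1 < q.1 ∨ (p.1 = q.1 ∧ p.2 < q.2)

/-- The levels are listed in loop order. [folklore] -/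
theorem pairwise_levels (k : ℕ) : (levels k).Pairwise LevLT := by
  unfold levels
  rw [List.pairwise_flatMap]
  refine ⟨fun j _ => ?_, ?_⟩
  · rw [List.pairwise_map]
    exact (List.pairwise_lt_range' (s := 1) (n := j - 1)).imp fun h => Or.inr ⟨rfl, h⟩
  · refine (List.pairwise_lt_range' (s := 2) (n := k - 1)).imp fun {j j'} hjj' => ?_
    intro p hp q hq
    simp only [List.mem_map] at hp hq
    obtain ⟨i, -, rfl⟩ := hp
    obtain ⟨i', -, rfl⟩ := hq
    exact Or.inl hjj'

/-- In the level list, a level smaller in loop order than a given occurrence comes before it.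
[folklore] -/
theorem mem_pre_of_levLT {k : ℕ} {pre post : List (ℕ × ℕ)} {q : ℕ × ℕ}
    (h : levels k = pre ++ q :: post) {p : ℕ × ℕ} (hp : p ∈ levels k) (hpq : LevLT p q) : p ∈ pre
        := by
  have hpw := pairwise_levels k
  rw [h] at hpw hp
  rw [List.mem_append, List.mem_cons] at hp
  rcases hp with hp | rfl | hp
  · exact hp
  · rcases hpq with h1 | ⟨_, h2⟩ <;> omega
  · have := (List.pairwise_append.1 hpw).2.1
    rw [List.pairwise_cons] at this
    have hqp := this.1 p hp
    rcases hpq with h1 | ⟨h1, h2⟩ <;> rcases hqp with h3 | ⟨h3, h4⟩ <;> omega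

/-! ### The scan is a valid selection rule -/

/-- The abstract branching of a find `(j, H)`: heart `litSet H`, petal size `j - |H|`, and all
the clauses of size `j` containing the heart.
[cite: ImpagliazzoPaturiZaneJCSS2001, §2 (lines 4–5 of Reduce)] -/
def br (n j : ℕ) (H : List Lit) (M : List (List Lit)) : Branch (Fin n × Bool) :=
  ⟨KCNF.litSet n H, j - H.length, Wset n j H M⟩

/-- **A find is a qualifying weak sunflower** of the loop level where it was found.
[cite: ImpagliazzoPaturiZaneJCSS2001, §2 (line 4 of Reduce)] -/
theorem qual_br {n k : ℕ} {θ : ℕ → ℕ} {F : List (List Lit)} (hF : WF n k F) {j i : ℕ}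
    (hi : 1 ≤ i) (hij : i < j) {H : List Lit} (h : findLevel θ (thetaL F) j i = some H) :
    Qual θ (shF n (thetaL F)) (br n j H (thetaL F)) ∧ (br n j H (thetaL F)).size = j ∧
      (br n j H (thetaL F)).i = i ∧ IdxLt n H ∧ H.Nodup ∧ H.length ≤ k := by
  set M := thetaL F with hM
  have hWF : WF n k M := hF.thetaL
  obtain ⟨s, hs, hsj, μ, hμ, rfl, hcnt⟩ := findS_eq_some h
  obtain ⟨hμl, hμc⟩ := (mem_masks_iff _ _ _).1 hμ
  obtain ⟨hHi, hHn, hHk⟩ := hWF.sublist hs (pick_sublist μ s)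
  have hHlen : (pick μ s).length = j - i := by rw [length_pick μ s (by rw [hμl, hsj]), hμc]
  have hHcard : (KCNF.litSet n (pick μ s)).card = j - i := by rw [card_litSet hHi hHn, hHlen]
  have hbi : (br n j (pick μ s) M).i = i := by simp only [br, hHlen]; omega
  have hbs : (br n j (pick μ s) M).size = j := by simp only [Branch.size, br, hHcard, hHlen]; omega
  refine ⟨⟨Wset_subset _ _ _ _, ?_, ?_, ?_, ?_⟩, hbs, hbi, hHi, hHn, hHk⟩
  · simp only [br]; rw [← Finset.card_pos, hHcard]; omega
  · rw [hbi]; exact hi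
  · rw [hbi]; simp only [br]; rw [← cntT_eq_card_Wset j _ hHi F hF]; exact hcnt
  · intro t ht
    simp only [br, Wset, Finset.mem_filter] at ht ⊢
    refine ⟨ht.2.2, ?_⟩
    rw [hHcard, ht.2.1]; omega

/-- A qualifying weak sunflower of a `Θ`-reduced well-formed family gives a level of the loop
order. [folklore] -/
theorem level_of_qual {n k : ℕ} {θ : ℕ → ℕ} (hθ : ∀ i, 1 ≤ θ i) {F : List (List Lit)} (hF : WF n
    k F)
    {b : Branch (Fin n × Bool)} (hb : Qual θ (shF n (thetaL F)) b) :
    (b.size, b.i) ∈ levels k := by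
  obtain ⟨hWF', hH, hi, hθc, hW⟩ := hb
  obtain ⟨s', hs'⟩ : b.W.Nonempty := Finset.card_pos.1 (lt_of_lt_of_le (hθ _) hθc)
  have hcard := (hW s' hs').2
  have hk : s'.card ≤ k := hF.thetaL.card_le (hWF' hs')
  have hH1 : 1 ≤ b.H.card := Finset.card_pos.2 hH
  rw [mem_levels_iff, Branch.size]
  omega

/-- **Nothing found at a level means no qualifying sunflower of that level.**
[cite: ImpagliazzoPaturiZaneJCSS2001, §2 (line 4 of Reduce)] -/
theorem not_qual_of_findLevel_none {n k : ℕ} {θ : ℕ → ℕ} (hθ : ∀ i, 1 ≤ θ i) {F : List (List Lit)}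
    (hF : WF n k F) {j i : ℕ} (h : findLevel θ (thetaL F) j i = none) {b : Branch (Fin n × Bool)}
    (hb : Qual θ (shF n (thetaL F)) b) (hsize : b.size = j) (hbi : b.i = i) : False := by
  set M := thetaL F with hM
  have hWF : WF n k M := hF.thetaL
  obtain ⟨hWF', hH, hi, hθc, hW⟩ := hb
  obtain ⟨s', hs'⟩ : b.W.Nonempty := Finset.card_pos.1 (lt_of_lt_of_le (hθ _) hθc)
  obtain ⟨hHs', hcard⟩ := hW s' hs'
  obtain ⟨s, hs, rfl⟩ := mem_shF.1 (hWF' hs')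
  have hsn := hWF.idx s hs
  have hsd := hWF.nodup s hs
  have hslen : s.length = j := by rw [← card_litSet hsn hsd, hcard, ← hsize, Branch.size]
  -- the heart as a sub-list of `s`
  set H₀ := s.filter (fun l => decide (∃ a ∈ b.H, ((a.1 : ℕ), a.2) = l)) with hH₀
  have hH₀sub : H₀.Sublist s := List.filter_sublist
  have hH₀set : KCNF.litSet n H₀ = b.H := by
    ext a
    rw [mem_litSet_iff, hH₀, List.mem_filter, decide_eq_true_eq]
    constructor
    · rintro ⟨-, a', ha', he⟩
      have : a' = a := by
        obtain ⟨a1, a2⟩ := a; obtain ⟨a1', a2'⟩ := a'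
        simp only [Prod.mk.injEq] at he ⊢
        exact ⟨Fin.ext he.1, he.2⟩
      exact this ▸ ha'
    · intro ha
      exact ⟨mem_litSet_iff.1 (hHs' ha), a, ha, rfl⟩
  obtain ⟨hH₀n, hH₀d, -⟩ := hWF.sublist hs hH₀sub
  obtain ⟨μ, hμl, hμp⟩ := exists_mask_of_sublist hH₀sub
  have hμc : μ.count true = j - i := by
    rw [← length_pick μ s hμl, hμp, ← card_litSet hH₀n hH₀d, hH₀set, ← hbi, ← hsize, Branch.size]
    omega
  have hμ : μ ∈ masks j (j - i) := (mem_masks_iff _ _ _).2 ⟨by rw [hμl, hslen], hμc⟩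
  have hlt := findS_eq_none h s hs hslen μ hμ
  rw [hμp, cntT_eq_card_Wset j H₀ hH₀n F hF] at hlt
  have hsub : b.W ⊆ Wset n j H₀ M := by
    intro t ht
    obtain ⟨hHt, hct⟩ := hW t ht
    simp only [Wset, Finset.mem_filter]
    refine ⟨hWF' ht, ?_, hH₀set ▸ hHt⟩
    rw [hct, ← hsize, Branch.size]
  have := (Finset.card_le_card hsub).trans_lt hlt
  rw [hbi] at hθc
  omega

/-- **A find is first in the loop order.** [cite: ImpagliazzoPaturiZaneJCSS2001, §2 (lines 2–4 of
    Reduce)] -/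
theorem lexMin_br {n k : ℕ} {θ : ℕ → ℕ} (hθ : ∀ i, 1 ≤ θ i) {F : List (List Lit)} (hF : WF n k F)
    {j : ℕ} {H : List Lit} (h : findBranch θ (thetaL F) (levels k) = some (j, H)) :
    Qual θ (shF n (thetaL F)) (br n j H (thetaL F)) ∧
      (∀ b', Qual θ (shF n (thetaL F)) b' → (br n j H (thetaL F)).LexLE b') ∧
      IdxLt n H ∧ H.Nodup ∧ H.length ≤ k := by
  obtain ⟨pre, i, post, hls, hfl, hpre⟩ := findBranch_eq_some h
  have hmem : (j, i) ∈ levels k := by rw [hls]; simp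
  obtain ⟨-, -, hi, hij⟩ := mem_levels_iff.1 hmem
  obtain ⟨hq, hsize, hbi, hHn, hHd, hHk⟩ := qual_br hF hi hij hfl
  refine ⟨hq, fun b' hb' => ?_, hHn, hHd, hHk⟩
  by_contra hlex
  have hlt : LevLT (b'.size, b'.i) (j, i) := by
    simp only [Branch.LexLE, hsize, hbi, not_or, not_and, not_le] at hlex
    simp only [LevLT]
    omega
  have hmem' := level_of_qual hθ hF hb'
  have := hpre _ (mem_pre_of_levLT hls hmem' hlt)
  exact not_qual_of_findLevel_none hθ hF this hb' rfl rfl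

/-- **No find means no qualifying weak sunflower at all.**
[cite: ImpagliazzoPaturiZaneJCSS2001, §2 (Reduce, the leaves)] -/
theorem not_qual_of_findBranch_none {n k : ℕ} {θ : ℕ → ℕ} (hθ : ∀ i, 1 ≤ θ i) {F : List (List Lit)}
    (hF : WF n k F) (h : findBranch θ (thetaL F) (levels k) = none) (b : Branch (Fin n × Bool)) :
    ¬ Qual θ (shF n (thetaL F)) b := fun hb =>
  not_qual_of_findLevel_none hθ hF (findBranch_eq_none h _ (level_of_qual hθ hF hb)) hb rfl rfl

/-! ### Children keep well-formedness -/

/-- The children of a well-formed family are well-formed (the heart and the petals are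
sub-lists of clauses). [folklore] -/
theorem WF.nodeKids {n k : ℕ} {θ : ℕ → ℕ} (hθ : ∀ i, 1 ≤ θ i) {F : List (List Lit)} (hF : WF n k
    F) :
    ∀ G ∈ nodeKids θ k F, WF n k G := by
  intro G hG
  unfold Sparsifier.nodeKids at hG
  split at hG
  · rename_i j H hfb
    obtain ⟨-, -, hHn, hHd, hHk⟩ := lexMin_br hθ hF hfb
    have hM : WF n k (Sparsifier.thetaL F) := hF.thetaL
    simp only [List.mem_cons, List.not_mem_nil, or_false] at hG
    rcases hG with rfl | rfl
    · refine ⟨?_, ?_, ?_⟩ <;> intro c hc <;> rw [List.mem_append, List.mem_singleton] at hc <;>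
        rcases hc with hc | rfl
      exacts [hM.idx c hc, hHn, hM.nodup c hc, hHd, hM.len c hc, hHk]
    · refine ⟨?_, ?_, ?_⟩ <;> intro c hc <;> rw [List.mem_append] at hc <;> rcases hc with hc | hc
      · exact hM.idx c hc
      · obtain ⟨t, ht, rfl⟩ := List.mem_map.1 hc
        exact (hM.sublist (List.mem_of_mem_filter ht) List.filter_sublist).1
      · exact hM.nodup c hc
      · obtain ⟨t, ht, rfl⟩ := List.mem_map.1 hc
        exact (hM.sublist (List.mem_of_mem_filter ht) List.filter_sublist).2.1
      · exact hM.len c hc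
      · obtain ⟨t, ht, rfl⟩ := List.mem_map.1 hc
        exact (hM.sublist (List.mem_of_mem_filter ht) List.filter_sublist).2.2
  · simp at hG

/-! ### The position oracle -/

/-- The family (before `Θ`) at tree position `p` (most recent branching first; `false` = heart
child, `true` = petal child), starting from the root family `F₀`. [folklore] -/
def famAt (θ : ℕ → ℕ) (k : ℕ) (F₀ : List (List Lit)) : List Bool → Option (List (List Lit))
  | [] => some F₀
  | b :: p => (famAt θ k F₀ p).bind fun F => (nodeKids θ k F)[if b then 1 else 0]?

/-- The children positions of a branching node. [folklore] -/
theorem famAt_cons_of_findBranch {θ : ℕ → ℕ} {k : ℕ} {F₀ : List (List Lit)} {p : List Bool}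
    {F : List (List Lit)} (hp : famAt θ k F₀ p = some F) {j : ℕ} {H : List Lit}
    (hfb : findBranch θ (thetaL F) (levels k) = some (j, H)) :
    famAt θ k F₀ (false :: p) = some (thetaL F ++ [H]) ∧
      famAt θ k F₀ (true :: p) = some (thetaL F ++ petalsL j H (thetaL F)) := by
  simp [famAt, hp, Sparsifier.nodeKids, hfb]

/-- Families at positions are well-formed. [folklore] -/
theorem WF.famAt {n k : ℕ} {θ : ℕ → ℕ} (hθ : ∀ i, 1 ≤ θ i) {F₀ : List (List Lit)} (h0 : WF n k F₀) :
    ∀ {p : List Bool} {F : List (List Lit)}, famAt θ k F₀ p = some F → WF n k F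
  | [], F, h => by simp [Sparsifier.famAt] at h; exact h ▸ h0
  | b :: p, F, h => by
    rw [Sparsifier.famAt] at h
    cases hq : Sparsifier.famAt θ k F₀ p with
    | none => simp [hq] at h
    | some G =>
      rw [hq, Option.bind_some] at h
      have hG := WF.famAt hθ h0 hq
      exact hG.nodeKids hθ _ (List.mem_of_getElem? h)

/-- **The position-dependent selection rule of the program**: at position `p`, if the family
there shadows to the family asked about, the find of the scan (read as an abstract branching);
otherwise a fixed valid default rule. [cite: ImpagliazzoPaturiZaneJCSS2001, §2 (Reduce)] -/
noncomputable def stepO (n k : ℕ) (θ : ℕ → ℕ) (F₀ : List (List Lit))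
    (dflt : Finset (Finset (Fin n × Bool)) → Option (Branch (Fin n × Bool))) (p : List Bool)
    (S : Finset (Finset (Fin n × Bool))) : Option (Branch (Fin n × Bool)) :=
  match famAt θ k F₀ p with
  | some F => if shF n (thetaL F) = S then
      (findBranch θ (thetaL F) (levels k)).map fun q => br n q.1 q.2 (thetaL F) else dflt S
  | none => dflt S

/-- **The rule is valid at every position.** [cite: ImpagliazzoPaturiZaneJCSS2001, §2 (Reduce)] -/
theorem isValidStep_stepO {n k : ℕ} {θ : ℕ → ℕ} (hθ : ∀ i, 1 ≤ θ i) {F₀ : List (List Lit)}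
    (h0 : WF n k F₀) {dflt : Finset (Finset (Fin n × Bool)) → Option (Branch (Fin n × Bool))}
    (hd : IsValidStep θ dflt) (p : List Bool) : IsValidStep θ (stepO n k θ F₀ dflt p) := by
  intro S
  unfold stepO
  cases hq : famAt θ k F₀ p with
  | none => exact hd S
  | some F =>
    simp only []
    by_cases hS : shF n (thetaL F) = S
    · rw [if_pos hS]
      subst hS
      have hF := h0.famAt hθ hq
      cases hfb : findBranch θ (thetaL F) (levels k) with
      | none =>
        simp only [Option.map_none, forall_const, reduceCtorEq, IsEmpty.forall_iff, implies_true,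
          and_true]
        exact not_qual_of_findBranch_none hθ hF hfb
      | some q =>
        obtain ⟨j, H⟩ := q
        simp only [Option.map_some, reduceCtorEq, IsEmpty.forall_iff, Option.some.injEq, true_and]
        rintro b rfl
        obtain ⟨h1, h2, -⟩ := lexMin_br hθ hF hfb
        exact ⟨h1, h2⟩
    · rw [if_neg hS]; exact hd S

/-! ### The model tree and the correspondence -/

/-- The leaves of the model tree below the family `F` explored with `fuel` levels, in the order
of `Sparsification.run` (heart subtree first). [cite: ImpagliazzoPaturiZaneJCSS2001, §2 (Reduce)] -/
def treeL (θ : ℕ → ℕ) (k : ℕ) : ℕ → List (List Lit) → List (List (List Lit))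
  | 0, F => [thetaL F]
  | f + 1, F =>
    match findBranch θ (thetaL F) (levels k) with
    | none => [thetaL F]
    | some (j, H) => treeL θ k f (thetaL F ++ [H]) ++ treeL θ k f (thetaL F ++ petalsL j H
        (thetaL F))

/-- The number of nodes of the model tree. [folklore] -/
def tnodes (θ : ℕ → ℕ) (k : ℕ) : ℕ → List (List Lit) → ℕ
  | 0, _ => 1
  | f + 1, F =>
    match findBranch θ (thetaL F) (levels k) with
    | none => 1
    | some (j, H) =>
      1 + tnodes θ k f (thetaL F ++ [H]) + tnodes θ k f (thetaL F ++ petalsL j H (thetaL F))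

/-- Nodes are fewer than twice the leaves. [folklore] -/
theorem tnodes_le (θ : ℕ → ℕ) (k : ℕ) : ∀ (f : ℕ) (F : List (List Lit)),
    tnodes θ k f F + 1 ≤ 2 * (treeL θ k f F).length
  | 0, F => by simp [tnodes, treeL]
  | f + 1, F => by
    rw [tnodes, treeL]
    cases findBranch θ (thetaL F) (levels k) with
    | none => simp
    | some q =>
      obtain ⟨j, H⟩ := q
      have h1 := tnodes_le θ k f (thetaL F ++ [H])
      have h2 := tnodes_le θ k f (thetaL F ++ petalsL j H (thetaL F))
      simp only [List.length_append]
      omega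

/-- The shadow of the petals is the abstract petal family. [folklore] -/
theorem shF_petalsL {n k : ℕ} (j : ℕ) {H : List Lit} (hH : IdxLt n H) {F : List (List Lit)}
    (hF : WF n k F) : shF n (petalsL j H (thetaL F)) = (br n j H (thetaL F)).petals := by
  have hWF : WF n k (thetaL F) := hF.thetaL
  ext t
  simp only [mem_shF, petalsL, List.mem_map, List.mem_filter, decide_eq_true_eq, Branch.petals, br,
    Finset.mem_image, Wset, Finset.mem_filter]
  constructor
  · rintro ⟨c, ⟨s, ⟨hs, hsel⟩, rfl⟩, rfl⟩
    refine ⟨KCNF.litSet n s, ⟨⟨s, hs, rfl⟩, ?_, (litSet_subset_iff hH).2 hsel.2⟩,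
      (litSet_filter_notMem s H).symm⟩
    rw [card_litSet (hWF.idx s hs) (hWF.nodup s hs)]; exact hsel.1
  · rintro ⟨u, ⟨⟨s, hs, rfl⟩, hcard, hsub⟩, rfl⟩
    refine ⟨s.filter fun l => l ∉ H, ⟨s, ⟨hs, ?_, (litSet_subset_iff hH).1 hsub⟩, rfl⟩,
      litSet_filter_notMem s H⟩
    rw [card_litSet (hWF.idx s hs) (hWF.nodup s hs)] at hcard; exact hcard

/-- **The correspondence.** Along the rule `stepO`, the leaves of `Sparsification.run` from a
node whose family is the shadow of `Θ` of the family at that position are the shadows of the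
leaves of the model tree. [cite: ImpagliazzoPaturiZaneJCSS2001, §2 (Reduce)] -/
theorem map_cur_run_eq {n k : ℕ} {θ : ℕ → ℕ} (hθ : ∀ i, 1 ≤ θ i) {F₀ : List (List Lit)}
    (h0 : WF n k F₀) (dflt : Finset (Finset (Fin n × Bool)) → Option (Branch (Fin n × Bool))) :
    ∀ (fuel : ℕ) (p : List Bool) (F : List (List Lit)) (σ : State (Fin n × Bool)),
      famAt θ k F₀ p = some F → σ.cur = shF n (thetaL F) →
      (run (stepO n k θ F₀ dflt) fuel p σ).map State.cur = (treeL θ k fuel F).map (shF n)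
  | 0, p, F, σ, hp, hσ => by simp [run, treeL, hσ]
  | f + 1, p, F, σ, hp, hσ => by
    have hF := h0.famAt hθ hp
    have hstep : stepO n k θ F₀ dflt p σ.cur =
        (findBranch θ (thetaL F) (levels k)).map fun q => br n q.1 q.2 (thetaL F) := by
      rw [stepO, hp]; simp [hσ]
    cases hfb : findBranch θ (thetaL F) (levels k) with
    | none =>
      rw [hfb, Option.map_none] at hstep
      rw [run_succ_of_none hstep, treeL, hfb]
      simp [hσ]
    | some q =>
      obtain ⟨j, H⟩ := q
      rw [hfb, Option.map_some] at hstep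
      rw [run_succ_of_some hstep, treeL, hfb, List.map_append, List.map_append]
      obtain ⟨hh, hpk⟩ := famAt_cons_of_findBranch hp hfb
      obtain ⟨-, -, hHn, hHd, hHk⟩ := lexMin_br hθ hF hfb
      have hM : WF n k (thetaL F) := hF.thetaL
      have hWFh : WF n k (thetaL F ++ [H]) := (h0.famAt hθ hh)
      have hWFp : WF n k (thetaL F ++ petalsL j H (thetaL F)) := (h0.famAt hθ hpk)
      congr 1
      · refine map_cur_run_eq hθ h0 dflt f _ _ _ hh ?_
        show minimals (σ.cur ∪ {(br n j H (thetaL F)).H}) = _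
        rw [shF_thetaL _ hWFh.idx, shF_append, shF_singleton, hσ]
        rfl
      · refine map_cur_run_eq hθ h0 dflt f _ _ _ hpk ?_
        show minimals (σ.cur ∪ (br n j H (thetaL F)).petals) = _
        rw [shF_thetaL _ hWFp.idx, shF_append, shF_petalsL j hHn hF, hσ]

/-- Leaves of the model tree are `Θ` of well-formed families. [folklore] -/
theorem exists_of_mem_treeL {n k : ℕ} {θ : ℕ → ℕ} (hθ : ∀ i, 1 ≤ θ i) :
    ∀ (f : ℕ) {F : List (List Lit)}, WF n k F → ∀ Ml ∈ treeL θ k f F,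
      ∃ G, WF n k G ∧ Ml = thetaL G
  | 0, F, hF, Ml, h => by simp only [treeL, List.mem_singleton] at h; exact ⟨F, hF, h⟩
  | f + 1, F, hF, Ml, h => by
    rw [treeL] at h
    split at h
    · rw [List.mem_singleton] at h; exact ⟨F, hF, h⟩
    · rename_i j H hfb
      have hk := hF.nodeKids hθ
      simp only [Sparsifier.nodeKids, hfb, List.mem_cons, List.not_mem_nil, or_false,
        forall_eq_or_imp, forall_eq] at hk
      rw [List.mem_append] at h
      rcases h with h | h
      · exact exists_of_mem_treeL hθ f hk.1 Ml h
      · exact exists_of_mem_treeL hθ f hk.2 Ml h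

/-- All leaves of the model tree are sunflower-free (the scan finds nothing). [folklore] -/
def TermL (θ : ℕ → ℕ) (k f : ℕ) (F : List (List Lit)) : Prop :=
  ∀ Ml ∈ treeL θ k f F, findBranch θ Ml (levels k) = none

/-- **The work-list traversal realises the model tree**: started on `F :: Lw` with at least
`tnodes` iterations, it emits the leaf encodings of the tree below `F` in order and continues
with `Lw`. [folklore] -/
theorem dfsOut_cons_eq (θ : ℕ → ℕ) (k : ℕ) (hd : List Γ') :
    ∀ (f : ℕ) (F : List (List Lit)), TermL θ k f F → ∀ (m : ℕ) (Lw : List (List (List Lit))),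
      tnodes θ k f F ≤ m →
      dfsOut θ k hd m (F :: Lw) =
          (treeL θ k f F).flatMap (leafW hd) ++ dfsOut θ k hd (m - tnodes θ k f F) Lw ∧
        (DfsDone θ k m (F :: Lw) ↔ DfsDone θ k (m - tnodes θ k f F) Lw)
  | 0, F, hT, m, Lw, hm => by
    have hfb : findBranch θ (thetaL F) (levels k) = none := hT _ (by simp [treeL])
    obtain ⟨m', rfl⟩ : ∃ m', m = m' + 1 := ⟨m - 1, by rw [tnodes] at hm; omega⟩
    have hkids : nodeKids θ k F = [] := by rw [Sparsifier.nodeKids, hfb]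
    have hout : nodeOut θ k hd F = leafW hd (thetaL F) := by rw [nodeOut, nodeLeaf, hfb]
    simp [dfsOut, DfsDone, treeL, tnodes, hkids, hout]
  | f + 1, F, hT, m, Lw, hm => by
    cases hfb : findBranch θ (thetaL F) (levels k) with
    | none =>
      obtain ⟨m', rfl⟩ : ∃ m', m = m' + 1 := ⟨m - 1, by simp only [tnodes, hfb] at hm; omega⟩
      have hkids : nodeKids θ k F = [] := by rw [Sparsifier.nodeKids, hfb]
      have hout : nodeOut θ k hd F = leafW hd (thetaL F) := by rw [nodeOut, nodeLeaf, hfb]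
      simp [dfsOut, DfsDone, treeL, tnodes, hfb, hkids, hout]
    | some q =>
      obtain ⟨j, H⟩ := q
      rw [tnodes, hfb] at hm
      simp only [] at hm
      set hk := thetaL F ++ [H] with hhk
      set pk := thetaL F ++ petalsL j H (thetaL F) with hpk
      obtain ⟨m', rfl⟩ : ∃ m', m = m' + 1 := ⟨m - 1, by omega⟩
      have hTh : TermL θ k f hk := fun Ml h =>
        hT Ml (by rw [treeL, hfb]; exact List.mem_append_left _ h)
      have hTp : TermL θ k f pk := fun Ml h =>
        hT Ml (by rw [treeL, hfb]; exact List.mem_append_right _ h)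
      have hkids : nodeKids θ k F = [hk, pk] := by rw [Sparsifier.nodeKids, hfb]
      have hout : nodeOut θ k hd F = [] := by rw [nodeOut, nodeLeaf, hfb]
      obtain ⟨e1, d1⟩ := dfsOut_cons_eq θ k hd f hk hTh m' (pk :: Lw) (by omega)
      obtain ⟨e2, d2⟩ := dfsOut_cons_eq θ k hd f pk hTp (m' - tnodes θ k f hk) Lw (by omega)
      have htn : tnodes θ k (f + 1) F = 1 + tnodes θ k f hk + tnodes θ k f pk := by
        rw [tnodes, hfb]
      have hsub : m' + 1 - (1 + tnodes θ k f hk + tnodes θ k f pk) =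
          m' - tnodes θ k f hk - tnodes θ k f pk := by omega
      rw [htn, hsub, dfsOut, DfsDone, hkids, hout, List.nil_append, List.cons_append,
        List.cons_append, List.nil_append, e1, e2, d1, d2, treeL, hfb]
      simp only [List.flatMap_append, List.append_assoc, iff_self, and_true, hhk, hpk]

/-- The empty work-list is done. [folklore] -/
theorem dfsDone_nil (θ : ℕ → ℕ) (k m : ℕ) : DfsDone θ k m [] := by cases m <;> trivial

/-- Nothing is emitted from the empty work-list. [folklore] -/
theorem dfsOut_nil (θ : ℕ → ℕ) (k : ℕ) (hd : List Γ') (m : ℕ) : dfsOut θ k hd m [] = [] := by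
  cases m <;> rfl

/-! ### The model satisfies the conclusions of Theorem 1 -/

/-- `Θ` of a `Θ`-reduced family has the same length?  We only need: the length of a leaf
`thetaL G` is the number of its literal sets. [folklore] -/
theorem length_eq_card_shF_of_thetaL {n k : ℕ} {G : List (List Lit)} (hG : WF n k G) :
    (thetaL G).length = (shF n (thetaL G)).card := by
  rw [length_thetaL_eq_card G hG.idx, shF_thetaL G hG.idx]

/-- **The model tree from a well-formed root family without the empty clause**: all leaves are
sunflower-free; there are at most `(1 + 1/y)^{A_k · 2n} · y^{k ⌊2n/M⌋}` of them; each is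
well-formed with at most `(∑_{j<k} θ_j) · 2n` clauses; and a set of literals covers the root
family iff it covers some leaf. (Lemmas 1, 2, 3–7 of the source through `Sparsification.run`.)
[cite: ImpagliazzoPaturiZaneJCSS2001, §2, Theorem 1 (proof)] -/
theorem treeL_spec {n k M₀ : ℕ} (hM₀ : 1 ≤ M₀) {y : ℝ} (hy : 1 ≤ y) {F₀ : List (List Lit)}
    (h0 : WF n k F₀) (hne : [] ∉ F₀) :
    TermL (Sparsification.theta M₀) k (2 ^ (2 * n) + 1) F₀ ∧
    (((treeL (Sparsification.theta M₀) k (2 ^ (2 * n) + 1) F₀).length : ℝ) ≤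
      (1 + 1 / y) ^ (abnd M₀ k * (2 * n)) * y ^ (k * (2 * n / M₀))) ∧
    (∀ Ml ∈ treeL (Sparsification.theta M₀) k (2 ^ (2 * n) + 1) F₀,
      WF n k Ml ∧ Ml.length ≤ (∑ j ∈ Finset.range k, Sparsification.theta M₀ j) * (2 * n)) ∧
    (∀ X, Covers X (shF n F₀) ↔
      ∃ Ml ∈ treeL (Sparsification.theta M₀) k (2 ^ (2 * n) + 1) F₀, Covers X (shF n Ml)) := by
  set θ := Sparsification.theta M₀ with hθdef
  have hθ1 : ∀ i, 1 ≤ θ i := one_le_theta hM₀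
  set fa := 2 ^ (2 * n) + 1 with hfa
  set S := shF n F₀ with hS
  have hSk : ∀ s ∈ S, s.card ≤ k := fun s hs => h0.card_le hs
  obtain ⟨dflt, hdflt⟩ := exists_isValidStep (α := Fin n × Bool) θ
  set step := stepO n k θ F₀ dflt with hstep_def
  have hstep : ∀ p, IsValidStep θ (step p) := isValidStep_stepO hθ1 h0 hdflt
  have hroot := Inv.root k M₀ S
  have hcur0 : (root S).cur = shF n (thetaL F₀) := by
    show minimals S = _; rw [shF_thetaL _ h0.idx]
  have hmap := map_cur_run_eq hθ1 h0 dflt fa [] F₀ (root S) rfl hcur0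
  set R := run step fa [] (root S) with hR
  set Ls := treeL θ k fa F₀ with hLs
  have hInv : ∀ τ ∈ R, Inv k M₀ S τ :=
    forall_mem_run (fun p σ b hσ h =>
      ⟨hσ.heartChild hM₀ ((hstep p _).2 b h).1 ((hstep p _).2 b h).2,
        hσ.petalChild hSk hM₀ ((hstep p _).2 b h).1 ((hstep p _).2 b h).2⟩) _ _ _ hroot
  have hcard : Fintype.card (Fin n × Bool) = 2 * n := by simp [Fintype.card_prod, mul_comm]
  have hterm : ∀ τ ∈ R, ∀ b, ¬ Qual θ τ.cur b :=
    run_terminal hSk hM₀ hstep _ _ _ hroot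
      (by rw [hfa, ← hcard]; exact Nat.lt_succ_of_le (freeCount_le _))
  -- leaves of the model correspond to leaves of the run
  have hmem : ∀ Ml ∈ Ls, ∃ τ ∈ R, τ.cur = shF n Ml := by
    intro Ml hMl
    have : shF n Ml ∈ R.map State.cur := by rw [hmap]; exact List.mem_map.2 ⟨Ml, hMl, rfl⟩
    obtain ⟨τ, hτ, e⟩ := List.mem_map.1 this
    exact ⟨τ, hτ, e⟩
  refine ⟨?_, ?_, ?_, ?_⟩
  · -- terminal
    intro Ml hMl
    obtain ⟨G, hG, rfl⟩ := exists_of_mem_treeL hθ1 fa h0 Ml hMl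
    obtain ⟨τ, hτ, hτc⟩ := hmem _ hMl
    cases hfb : findBranch θ (thetaL G) (levels k) with
    | none => rfl
    | some q =>
      obtain ⟨j, H⟩ := q
      obtain ⟨hq, -⟩ := lexMin_br hθ1 hG hfb
      rw [← hτc] at hq
      exact absurd hq (hterm τ hτ _)
  · -- count
    have h := length_run_le hSk hM₀ hstep hy fa [] (root S) hroot
    rw [show (root S).add.card = 0 from rfl, show (root S).ps.length = 0 from rfl] at h
    simp only [Nat.cast_zero, sub_zero, zpow_natCast, hcard] at h
    have hlen : Ls.length = R.length := by
      have := congrArg List.length hmap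
      simp only [List.length_map] at this
      exact this.symm
    rw [hlen]; exact h
  · -- leaves
    intro Ml hMl
    obtain ⟨G, hG, rfl⟩ := exists_of_mem_treeL hθ1 fa h0 Ml hMl
    obtain ⟨τ, hτ, hτc⟩ := hmem _ hMl
    have hI := hInv τ hτ
    refine ⟨hG.thetaL, ?_⟩
    rw [length_eq_card_shF_of_thetaL hG, ← hτc]
    have hne' : ∀ s ∈ τ.cur, s.Nonempty := by
      intro s hs
      rcases Finset.mem_union.1 (hI.cur_subset hs) with h | h
      · obtain ⟨c, hc, rfl⟩ := mem_shF.1 h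
        rw [Finset.nonempty_iff_ne_empty, Ne, litSet_eq_empty_iff (h0.idx c hc)]
        rintro rfl; exact hne hc
      · exact hI.add_nonempty s h
    rw [← Finset.filter_true_of_mem hne']
    refine (card_filter_nonempty_le_of_terminal hθ1 (hterm τ hτ) fun s hs => ?_).trans
      (by rw [hcard])
    obtain ⟨t, ht, hst⟩ := hI.subset_orig s (Finset.mem_union_left _ hs)
    exact (Finset.card_le_card hst).trans (hSk t ht)
  · -- covers
    intro X
    have h := covers_iff_exists_leaf hstep X fa [] (root S)
    rw [show (root S).cur = minimals S from rfl, covers_minimals_iff] at h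
    rw [h]
    constructor
    · rintro ⟨τ, hτ, hX⟩
      have : τ.cur ∈ Ls.map (shF n) := by rw [← hmap]; exact List.mem_map.2 ⟨τ, hτ, rfl⟩
      obtain ⟨Ml, hMl, e⟩ := List.mem_map.1 this
      exact ⟨Ml, hMl, e ▸ hX⟩
    · rintro ⟨Ml, hMl, hX⟩
      obtain ⟨τ, hτ, hτc⟩ := hmem Ml hMl
      exact ⟨τ, hτ, hτc ▸ hX⟩

/-! ### Polynomial bounds on the step counts -/

/-- An atom bounded by `S`. [folklore] -/
theorem pw_atom {S a : ℕ} (h : a ≤ S) : a ≤ S ^ 1 := by simpa using h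

/-- Product of bounded terms. [folklore] -/
theorem pw_mul {S a b da db : ℕ} (ha : a ≤ S ^ da) (hb : b ≤ S ^ db) : a * b ≤ S ^ (da + db) := by
  rw [pow_add]; exact Nat.mul_le_mul ha hb

/-- Sum of bounded terms. [folklore] -/
theorem pw_add {S a b da db : ℕ} (hS : 2 ≤ S) (ha : a ≤ S ^ da) (hb : b ≤ S ^ db) :
    a + b ≤ S ^ (max da db + 1) := by
  have h1 : a ≤ S ^ max da db := ha.trans (Nat.pow_le_pow_right (by omega) (le_max_left _ _))
  have h2 : b ≤ S ^ max da db := hb.trans (Nat.pow_le_pow_right (by omega) (le_max_right _ _))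
  rw [pow_succ]
  nlinarith

/-- Polynomial bound for `cTh1`. [folklore] -/
theorem cTh1_le {S : ℕ} (hS : 64 ≤ S) {L kk : ℕ} (hL : L ≤ S) (hk : kk ≤ S) (_h2k : 2 ^ kk ≤ S) :
    cTh1 L kk ≤ S ^ 8 := by
  have hS2 : 2 ≤ S := by omega
  unfold cTh1
  exact (pw_add hS2 (pw_add hS2 (pw_mul (pw_mul (pw_mul (pw_atom (by omega : 42 ≤ S)) (pw_add hS2
    (pw_atom hL) (pw_atom (by omega : 1 ≤ S)))) (pw_add hS2 (pw_atom hk) (pw_atom (by omega : 1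
    ≤ S)))) (pw_atom hk)) (pw_mul (pw_atom (by omega : 5 ≤ S)) (pw_mul (pw_add hS2 (pw_atom hL)
    (pw_atom (by omega : 1 ≤ S))) (pw_atom hk)))) (pw_atom (by omega : 12 ≤ S)))

/-- Polynomial bound for `cPass1`. [folklore] -/
theorem cPass1_le {S : ℕ}
    (hS : 64 ≤ S) {L kk m : ℕ} (hL : L ≤ S) (hk : kk ≤ S) (hm : m ≤ S) (h2k : 2 ^ kk ≤ S) :
    cPass1 L kk m ≤ S ^ 13 := by
  have hS2 : 2 ≤ S := by omega
  unfold cPass1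
  exact (pw_add hS2 (pw_add hS2 (pw_mul (pw_add hS2 (pw_add hS2 (pw_mul (pw_atom (by omega : 4 ≤ S))
    (pw_mul (pw_add hS2 (pw_atom hL) (pw_atom (by omega : 1 ≤ S))) (pw_atom hk))) (cTh1_le hS hL
    hk h2k)) (pw_atom (by omega : 6 ≤ S))) (pw_atom hm)) (pw_mul (pw_atom (by omega : 3 ≤ S))
    (pw_mul (pw_add hS2 (pw_mul (pw_add hS2 (pw_atom hL) (pw_atom (by omega : 1 ≤ S))) (pw_atom
    hk)) (pw_atom (by omega : 2 ≤ S))) (pw_atom hm)))) (pw_atom (by omega : 2 ≤ S)))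

/-- Polynomial bound for `cTh2`. [folklore] -/
theorem cTh2_le {S : ℕ} (hS : 64 ≤ S) {L kk : ℕ} (hL : L ≤ S) (hk : kk ≤ S) (_h2k : 2 ^ kk ≤ S) :
    cTh2 L kk ≤ S ^ 8 := by
  have hS2 : 2 ≤ S := by omega
  unfold cTh2
  exact (pw_add hS2 (pw_add hS2 (pw_mul (pw_mul (pw_mul (pw_atom (by omega : 42 ≤ S)) (pw_add hS2
    (pw_atom hL) (pw_atom (by omega : 1 ≤ S)))) (pw_add hS2 (pw_atom hk) (pw_atom (by omega : 1
    ≤ S)))) (pw_atom hk)) (pw_mul (pw_atom (by omega : 30 ≤ S)) (pw_mul (pw_add hS2 (pw_atom hL)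
    (pw_atom (by omega : 1 ≤ S))) (pw_atom hk)))) (pw_atom (by omega : 24 ≤ S)))

/-- Polynomial bound for `cPass2`. [folklore] -/
theorem cPass2_le {S : ℕ}
    (hS : 64 ≤ S) {L kk m : ℕ} (hL : L ≤ S) (hk : kk ≤ S) (hm : m ≤ S) (h2k : 2 ^ kk ≤ S) :
    cPass2 L kk m ≤ S ^ 15 := by
  have hS2 : 2 ≤ S := by omega
  unfold cPass2
  exact (pw_add hS2 (pw_add hS2 (pw_add hS2 (pw_add hS2 (pw_mul (pw_add hS2 (pw_add hS2 (pw_mul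
    (pw_atom (by omega : 4 ≤ S)) (pw_mul (pw_add hS2 (pw_atom hL) (pw_atom (by omega : 1 ≤ S)))
    (pw_atom hk))) (cTh2_le hS hL hk h2k)) (pw_atom (by omega : 6 ≤ S))) (pw_atom hm)) (pw_mul
    (pw_atom (by omega : 2 ≤ S)) (pw_mul (pw_add hS2 (pw_mul (pw_add hS2 (pw_atom hL) (pw_atom
    (by omega : 1 ≤ S))) (pw_atom hk)) (pw_atom (by omega : 2 ≤ S))) (pw_atom hm)))) (pw_mul
    (pw_atom (by omega : 3 ≤ S)) (pw_mul (pw_add hS2 (pw_mul (pw_add hS2 (pw_atom hL) (pw_atom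
    (by omega : 1 ≤ S))) (pw_atom hk)) (pw_atom (by omega : 2 ≤ S))) (pw_add hS2 (pw_atom hm)
    (pw_atom (by omega : 1 ≤ S)))))) (pw_mul (pw_atom (by omega : 3 ≤ S)) (pw_mul (pw_add hS2
    (pw_atom hL) (pw_atom (by omega : 1 ≤ S))) (pw_atom hk)))) (pw_atom (by omega : 8 ≤ S)))

/-- Polynomial bound for `cThAct`. [folklore] -/
theorem cThAct_le {S : ℕ}
    (hS : 64 ≤ S) {L kk n : ℕ} (hL : L ≤ S) (hk : kk ≤ S) (hn : n ≤ S) (h2k : 2 ^ kk ≤ S) :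
    cThAct L kk n ≤ S ^ 17 := by
  have hS2 : 2 ≤ S := by omega
  unfold cThAct
  exact (pw_add hS2 (pw_add hS2 (pw_add hS2 (pw_add hS2 (pw_mul (pw_atom (by omega : 3 ≤ S)) (pw_mul
    (pw_add hS2 (pw_atom hL) (pw_atom (by omega : 1 ≤ S))) (pw_atom hk))) (cPass1_le hS hL hk hn
    h2k)) (pw_add hS2 (pw_add hS2 (pw_mul (pw_atom (by omega : 2 ≤ S)) (pw_atom hn)) (pw_mul
    (pw_atom (by omega : 2 ≤ S)) (pw_mul (pw_add hS2 (pw_atom hL) (pw_atom (by omega : 1 ≤ S)))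
    (pw_atom hk)))) (pw_atom (by omega : 2 ≤ S)))) (cPass2_le hS hL hk hn h2k)) (pw_atom (by
    omega : 7 ≤ S)))

/-- Polynomial bound for `cTheta`. [folklore] -/
theorem cTheta_le {S : ℕ}
    (hS : 64 ≤ S) {L kk n : ℕ} (hL : L ≤ S) (hk : kk ≤ S) (hn : n ≤ S) (h2k : 2 ^ kk ≤ S) :
    cTheta L kk n ≤ S ^ 22 := by
  have hS2 : 2 ≤ S := by omega
  unfold cTheta
  exact (pw_add hS2 (pw_add hS2 (pw_mul (pw_add hS2 (pw_add hS2 (pw_mul (pw_atom (by omega : 4 ≤ S))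
    (pw_mul (pw_add hS2 (pw_atom hL) (pw_atom (by omega : 1 ≤ S))) (pw_atom hk))) (cThAct_le hS
    hL hk hn h2k)) (pw_atom (by omega : 6 ≤ S))) (pw_atom hn)) (pw_mul (pw_atom (by omega : 2 ≤
    S)) (pw_mul (pw_add hS2 (pw_mul (pw_add hS2 (pw_atom hL) (pw_atom (by omega : 1 ≤ S)))
    (pw_atom hk)) (pw_atom (by omega : 2 ≤ S))) (pw_atom hn)))) (pw_atom (by omega : 2 ≤ S)))

/-- Polynomial bound for `cExtract`. [folklore] -/
theorem cExtract_le {S : ℕ}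
    (hS : 64 ≤ S) {L kk mu : ℕ} (hL : L ≤ S) (hk : kk ≤ S) (hmu : mu ≤ S) (_h2k : 2 ^ kk ≤ S) :
    cExtract L kk mu ≤ S ^ 7 := by
  have hS2 : 2 ≤ S := by omega
  unfold cExtract
  exact (pw_add hS2 (pw_add hS2 (pw_add hS2 (pw_mul (pw_atom (by omega : 3 ≤ S)) (pw_atom hmu))
    (pw_mul (pw_add hS2 (pw_mul (pw_atom (by omega : 10 ≤ S)) (pw_atom hL)) (pw_atom (by omega :
    8 ≤ S))) (pw_atom hk))) (pw_mul (pw_atom (by omega : 6 ≤ S)) (pw_mul (pw_add hS2 (pw_atom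
    hL) (pw_atom (by omega : 1 ≤ S))) (pw_atom hk)))) (pw_atom (by omega : 5 ≤ S)))

/-- Polynomial bound for `cCountAct`. [folklore] -/
theorem cCountAct_le {S : ℕ}
    (hS : 64 ≤ S) {L kk : ℕ} (hL : L ≤ S) (hk : kk ≤ S) (_h2k : 2 ^ kk ≤ S) :
    cCountAct L kk ≤ S ^ 9 := by
  have hS2 : 2 ≤ S := by omega
  unfold cCountAct
  exact (pw_add hS2 (pw_add hS2 (pw_add hS2 (pw_mul (pw_mul (pw_mul (pw_atom (by omega : 42 ≤ S))
    (pw_add hS2 (pw_atom hL) (pw_atom (by omega : 1 ≤ S)))) (pw_add hS2 (pw_atom hk) (pw_atom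
    (by omega : 1 ≤ S)))) (pw_atom hk)) (pw_mul (pw_atom (by omega : 18 ≤ S)) (pw_mul (pw_add
    hS2 (pw_atom hL) (pw_atom (by omega : 1 ≤ S))) (pw_atom hk)))) (pw_mul (pw_atom (by omega :
    6 ≤ S)) (pw_atom hk))) (pw_atom (by omega : 25 ≤ S)))

/-- Polynomial bound for `cCount`. [folklore] -/
theorem cCount_le {S : ℕ}
    (hS : 64 ≤ S) {L kk n : ℕ} (hL : L ≤ S) (hk : kk ≤ S) (hn : n ≤ S) (h2k : 2 ^ kk ≤ S) :
    cCount L kk n ≤ S ^ 15 := by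
  have hS2 : 2 ≤ S := by omega
  unfold cCount
  exact (pw_add hS2 (pw_add hS2 (pw_add hS2 (pw_mul (pw_atom (by omega : 10 ≤ S)) (pw_mul (pw_add
    hS2 (pw_mul (pw_add hS2 (pw_atom hL) (pw_atom (by omega : 1 ≤ S))) (pw_atom hk)) (pw_atom
    (by omega : 2 ≤ S))) (pw_atom hn))) (pw_atom (by omega : 3 ≤ S))) (pw_add hS2 (pw_mul
    (pw_add hS2 (pw_add hS2 (pw_mul (pw_atom (by omega : 4 ≤ S)) (pw_mul (pw_add hS2 (pw_atom
    hL) (pw_atom (by omega : 1 ≤ S))) (pw_atom hk))) (cCountAct_le hS hL hk h2k)) (pw_atom (by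
    omega : 6 ≤ S))) (pw_atom hn)) (pw_atom (by omega : 1 ≤ S)))) (pw_add hS2 (pw_mul (pw_atom
    (by omega : 2 ≤ S)) (pw_mul (pw_add hS2 (pw_mul (pw_add hS2 (pw_atom hL) (pw_atom (by omega
    : 1 ≤ S))) (pw_atom hk)) (pw_atom (by omega : 2 ≤ S))) (pw_atom hn))) (pw_atom (by omega : 1
    ≤ S))))

/-- Polynomial bound for `cEmit`. [folklore] -/
theorem cEmit_le {S : ℕ} (hS : 64 ≤ S) {L kk : ℕ} (hL : L ≤ S) (hk : kk ≤ S) (_h2k : 2 ^ kk ≤ S) :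
    cEmit L kk ≤ S ^ 9 := by
  have hS2 : 2 ≤ S := by omega
  unfold cEmit
  exact (pw_add hS2 (pw_add hS2 (pw_mul (pw_atom (by omega : 18 ≤ S)) (pw_mul (pw_add hS2 (pw_atom
    hL) (pw_atom (by omega : 1 ≤ S))) (pw_atom hk))) (pw_mul (pw_add hS2 (pw_add hS2 (pw_mul
    (pw_mul (pw_atom (by omega : 36 ≤ S)) (pw_add hS2 (pw_atom hL) (pw_atom (by omega : 1 ≤
    S)))) (pw_atom hk)) (pw_mul (pw_atom (by omega : 8 ≤ S)) (pw_atom hL))) (pw_atom (by omega :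
    15 ≤ S))) (pw_atom hk))) (pw_atom (by omega : 9 ≤ S)))

/-- Polynomial bound for `cPetalAct`. [folklore] -/
theorem cPetalAct_le {S : ℕ}
    (hS : 64 ≤ S) {L kk : ℕ} (hL : L ≤ S) (hk : kk ≤ S) (h2k : 2 ^ kk ≤ S) :
    cPetalAct L kk ≤ S ^ 13 := by
  have hS2 : 2 ≤ S := by omega
  unfold cPetalAct
  exact (pw_add hS2 (pw_add hS2 (pw_add hS2 (pw_add hS2 (pw_mul (pw_mul (pw_mul (pw_atom (by omega :
    42 ≤ S)) (pw_add hS2 (pw_atom hL) (pw_atom (by omega : 1 ≤ S)))) (pw_add hS2 (pw_atom hk)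
    (pw_atom (by omega : 1 ≤ S)))) (pw_atom hk)) (cEmit_le hS hL hk h2k)) (pw_mul (pw_atom (by
    omega : 18 ≤ S)) (pw_mul (pw_add hS2 (pw_atom hL) (pw_atom (by omega : 1 ≤ S))) (pw_atom
    hk)))) (pw_mul (pw_atom (by omega : 6 ≤ S)) (pw_atom hk))) (pw_atom (by omega : 25 ≤ S)))

/-- Polynomial bound for `cPetal`. [folklore] -/
theorem cPetal_le {S : ℕ}
    (hS : 64 ≤ S) {L kk n : ℕ} (hL : L ≤ S) (hk : kk ≤ S) (hn : n ≤ S) (h2k : 2 ^ kk ≤ S) :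
    cPetal L kk n ≤ S ^ 21 := by
  have hS2 : 2 ≤ S := by omega
  unfold cPetal
  exact (pw_add hS2 (pw_add hS2 (pw_add hS2 (pw_add hS2 (pw_add hS2 (pw_mul (pw_atom (by omega : 17
    ≤ S)) (pw_mul (pw_add hS2 (pw_mul (pw_add hS2 (pw_atom hL) (pw_atom (by omega : 1 ≤ S)))
    (pw_atom hk)) (pw_atom (by omega : 2 ≤ S))) (pw_atom hn))) (pw_atom (by omega : 5 ≤ S)))
    (pw_add hS2 (pw_mul (pw_add hS2 (pw_add hS2 (pw_mul (pw_atom (by omega : 4 ≤ S)) (pw_mul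
    (pw_add hS2 (pw_atom hL) (pw_atom (by omega : 1 ≤ S))) (pw_atom hk))) (cPetalAct_le hS hL hk
    h2k)) (pw_atom (by omega : 6 ≤ S))) (pw_atom hn)) (pw_atom (by omega : 1 ≤ S)))) (pw_add hS2
    (pw_mul (pw_atom (by omega : 2 ≤ S)) (pw_mul (pw_add hS2 (pw_mul (pw_add hS2 (pw_atom hL)
    (pw_atom (by omega : 1 ≤ S))) (pw_atom hk)) (pw_atom (by omega : 2 ≤ S))) (pw_atom hn)))
    (pw_atom (by omega : 1 ≤ S)))) (pw_atom (by omega : 1 ≤ S))) (pw_add hS2 (pw_mul (pw_atom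
    (by omega : 3 ≤ S)) (pw_add hS2 (pw_mul (pw_add hS2 (pw_mul (pw_add hS2 (pw_atom hL)
    (pw_atom (by omega : 1 ≤ S))) (pw_atom hk)) (pw_atom (by omega : 2 ≤ S))) (pw_mul (pw_atom
    (by omega : 2 ≤ S)) (pw_atom hn))) (pw_atom (by omega : 1 ≤ S)))) (pw_atom (by omega : 1 ≤
    S))))

/-- Polynomial bound for `cHeart`. [folklore] -/
theorem cHeart_le {S : ℕ}
    (hS : 64 ≤ S) {L kk n : ℕ} (hL : L ≤ S) (hk : kk ≤ S) (hn : n ≤ S) (_h2k : 2 ^ kk ≤ S) :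
    cHeart L kk n ≤ S ^ 10 := by
  have hS2 : 2 ≤ S := by omega
  unfold cHeart
  exact (pw_add hS2 (pw_add hS2 (pw_add hS2 (pw_mul (pw_atom (by omega : 7 ≤ S)) (pw_mul (pw_add hS2
    (pw_mul (pw_add hS2 (pw_atom hL) (pw_atom (by omega : 1 ≤ S))) (pw_atom hk)) (pw_atom (by
    omega : 2 ≤ S))) (pw_atom hn))) (pw_mul (pw_atom (by omega : 3 ≤ S)) (pw_mul (pw_add hS2
    (pw_atom hL) (pw_atom (by omega : 1 ≤ S))) (pw_atom hk)))) (pw_mul (pw_atom (by omega : 3 ≤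
    S)) (pw_add hS2 (pw_mul (pw_add hS2 (pw_mul (pw_add hS2 (pw_atom hL) (pw_atom (by omega : 1
    ≤ S))) (pw_atom hk)) (pw_atom (by omega : 2 ≤ S))) (pw_add hS2 (pw_atom hn) (pw_atom (by
    omega : 1 ≤ S)))) (pw_atom (by omega : 1 ≤ S))))) (pw_atom (by omega : 8 ≤ S)))

/-- Polynomial bound for `cKids`. [folklore] -/
theorem cKids_le {S : ℕ}
    (hS : 64 ≤ S) {L kk n : ℕ} (hL : L ≤ S) (hk : kk ≤ S) (hn : n ≤ S) (h2k : 2 ^ kk ≤ S) :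
    cKids L kk n ≤ S ^ 22 := by
  have hS2 : 2 ≤ S := by omega
  unfold cKids
  exact (pw_add hS2 (cPetal_le hS hL hk hn h2k) (cHeart_le hS hL hk hn h2k))

/-- Polynomial bound for `cTry`. [folklore] -/
theorem cTry_le {S : ℕ}
    (hS : 64 ≤ S) {L kk n th : ℕ} (hL : L ≤ S) (hk : kk ≤ S) (hn : n ≤ S) (hth : th ≤ S) (h2k : 2
        ^ kk ≤ S) :
    cTry L kk n th ≤ S ^ 26 := by
  have hS2 : 2 ≤ S := by omega
  unfold cTry
  exact (pw_add hS2 (pw_add hS2 (pw_add hS2 (pw_add hS2 (pw_add hS2 (pw_add hS2 (cExtract_le hS hL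
    hk hk h2k) (cCount_le hS hL hk hn h2k)) (pw_mul (pw_atom (by omega : 2 ≤ S)) (pw_atom hth)))
    (cKids_le hS hL hk hn h2k)) (pw_mul (pw_atom (by omega : 2 ≤ S)) (pw_atom hn))) (pw_mul
    (pw_atom (by omega : 2 ≤ S)) (pw_mul (pw_add hS2 (pw_atom hL) (pw_atom (by omega : 1 ≤ S)))
    (pw_atom hk)))) (pw_atom (by omega : 10 ≤ S)))

/-- Polynomial bound for `cProcS`. [folklore] -/
theorem cProcS_le {S : ℕ}
    (hS : 64 ≤ S) {L kk n th : ℕ} (hL : L ≤ S) (hk : kk ≤ S) (hn : n ≤ S) (hth : th ≤ S) (h2k : 2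
        ^ kk ≤ S) :
    cProcS L kk n th ≤ S ^ 31 := by
  have hS2 : 2 ≤ S := by omega
  unfold cProcS
  exact (pw_add hS2 (pw_add hS2 (pw_add hS2 (pw_mul (pw_atom (by omega : 6 ≤ S)) (pw_mul (pw_add hS2
    (pw_atom hL) (pw_atom (by omega : 1 ≤ S))) (pw_atom hk))) (pw_mul (pw_atom h2k) (pw_add hS2
    (cTry_le hS hL hk hn hth h2k) (pw_atom (by omega : 3 ≤ S))))) (pw_mul (pw_atom (by omega : 6
    ≤ S)) (pw_atom hk))) (pw_atom (by omega : 12 ≤ S)))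

/-- Polynomial bound for `cLevel`. [folklore] -/
theorem cLevel_le {S : ℕ}
    (hS : 64 ≤ S) {L kk n th : ℕ} (hL : L ≤ S) (hk : kk ≤ S) (hn : n ≤ S) (hth : th ≤ S) (h2k : 2
        ^ kk ≤ S) :
    cLevel L kk n th ≤ S ^ 36 := by
  have hS2 : 2 ≤ S := by omega
  unfold cLevel
  exact (pw_add hS2 (pw_add hS2 (pw_mul (pw_atom (by omega : 12 ≤ S)) (pw_mul (pw_add hS2 (pw_mul
    (pw_add hS2 (pw_atom hL) (pw_atom (by omega : 1 ≤ S))) (pw_atom hk)) (pw_atom (by omega : 2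
    ≤ S))) (pw_atom hn))) (pw_mul (pw_add hS2 (pw_add hS2 (pw_mul (pw_atom (by omega : 4 ≤ S))
    (pw_mul (pw_add hS2 (pw_atom hL) (pw_atom (by omega : 1 ≤ S))) (pw_atom hk))) (cProcS_le hS
    hL hk hn hth h2k)) (pw_atom (by omega : 6 ≤ S))) (pw_atom hn))) (pw_atom (by omega : 5 ≤
    S)))

/-- Polynomial bound for `cScan`. [folklore] -/
theorem cScan_le {S : ℕ}
    (hS : 64 ≤ S) {L kk n th : ℕ} (hL : L ≤ S) (hk : kk ≤ S) (hn : n ≤ S) (hth : th ≤ S) (h2k : 2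
        ^ kk ≤ S) :
    cScan L kk n th ≤ S ^ 39 := by
  have hS2 : 2 ≤ S := by omega
  unfold cScan
  exact (pw_mul (pw_add hS2 (cLevel_le hS hL hk hn hth h2k) (pw_atom (by omega : 3 ≤ S))) (pw_mul
    (pw_atom hk) (pw_atom hk)))

/-- Polynomial bound for `cNormC`. [folklore] -/
theorem cNormC_le {S : ℕ} (hS : 64 ≤ S) {L kk : ℕ} (hL : L ≤ S) (hk : kk ≤ S) (_h2k : 2 ^ kk ≤ S) :
    cNormC L kk ≤ S ^ 9 := by
  have hS2 : 2 ≤ S := by omega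
  unfold cNormC
  exact (pw_add hS2 (pw_add hS2 (pw_mul (pw_atom (by omega : 3 ≤ S)) (pw_mul (pw_add hS2 (pw_atom
    hL) (pw_atom (by omega : 1 ≤ S))) (pw_atom hk))) (pw_mul (pw_add hS2 (pw_add hS2 (pw_mul
    (pw_mul (pw_atom (by omega : 36 ≤ S)) (pw_add hS2 (pw_atom hL) (pw_atom (by omega : 1 ≤
    S)))) (pw_atom hk)) (pw_mul (pw_atom (by omega : 8 ≤ S)) (pw_atom hL))) (pw_atom (by omega :
    15 ≤ S))) (pw_atom hk))) (pw_atom (by omega : 4 ≤ S)))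

/-- Polynomial bound for `cNorm`. [folklore] -/
theorem cNorm_le {S : ℕ}
    (hS : 64 ≤ S) {L kk m : ℕ} (hL : L ≤ S) (hk : kk ≤ S) (hm : m ≤ S) (h2k : 2 ^ kk ≤ S) :
    cNorm L kk m ≤ S ^ 16 := by
  have hS2 : 2 ≤ S := by omega
  unfold cNorm
  exact (pw_add hS2 (pw_add hS2 (pw_add hS2 (pw_mul (pw_add hS2 (pw_add hS2 (pw_mul (pw_atom (by
    omega : 4 ≤ S)) (pw_mul (pw_add hS2 (pw_atom hL) (pw_atom (by omega : 1 ≤ S))) (pw_atom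
    hk))) (pw_add hS2 (cNormC_le hS hL hk h2k) (pw_atom (by omega : 4 ≤ S)))) (pw_atom (by omega
    : 6 ≤ S))) (pw_atom hm)) (pw_mul (pw_atom (by omega : 2 ≤ S)) (pw_mul (pw_add hS2 (pw_mul
    (pw_add hS2 (pw_atom hL) (pw_atom (by omega : 1 ≤ S))) (pw_atom hk)) (pw_atom (by omega : 2
    ≤ S))) (pw_atom hm)))) (pw_mul (pw_atom (by omega : 3 ≤ S)) (pw_add hS2 (pw_mul (pw_add hS2
    (pw_mul (pw_add hS2 (pw_atom hL) (pw_atom (by omega : 1 ≤ S))) (pw_atom hk)) (pw_atom (by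
    omega : 2 ≤ S))) (pw_atom hm)) (pw_atom (by omega : 1 ≤ S))))) (pw_atom (by omega : 5 ≤ S)))

/-- Polynomial bound for `cNode`. [folklore] -/
theorem cNode_le {S : ℕ}
    (hS : 64 ≤ S) {L kk n th hdl wlen : ℕ} (hL : L ≤ S) (hk : kk ≤ S) (hn : n ≤ S) (hth : th ≤ S)
        (hhdl : hdl ≤ S) (h2k : 2 ^ kk ≤ S) (hw : wlen ≤ S ^ 8) :
    cNode L kk n th hdl wlen ≤ S ^ 43 := by
  have hS2 : 2 ≤ S := by omega
  unfold cNode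
  exact (pw_add hS2 (pw_add hS2 (pw_add hS2 (pw_add hS2 (pw_add hS2 (pw_mul (pw_atom (by omega : 6 ≤
    S)) (pw_add hS2 (pw_mul (pw_add hS2 (pw_mul (pw_add hS2 (pw_atom hL) (pw_atom (by omega : 1
    ≤ S))) (pw_atom hk)) (pw_atom (by omega : 2 ≤ S))) (pw_atom hn)) hw)) (cTheta_le hS hL hk hn
    h2k)) (cScan_le hS hL hk hn hth h2k)) (pw_mul (pw_atom (by omega : 7 ≤ S)) (pw_atom hhdl)))
    (pw_mul (pw_atom (by omega : 5 ≤ S)) (pw_mul (pw_add hS2 (pw_mul (pw_add hS2 (pw_atom hL)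
    (pw_atom (by omega : 1 ≤ S))) (pw_atom hk)) (pw_atom (by omega : 2 ≤ S))) (pw_atom hn))))
    (pw_atom (by omega : 20 ≤ S)))

/-- Polynomial bound for `cMain`. [folklore] -/
theorem cMain_le {S : ℕ}
    (hS : 64 ≤ S) {L kk th Nf m hdl fuel : ℕ} (hL : L ≤ S) (hk : kk ≤ S) (hth : th ≤ S) (hNf : Nf
        ≤ S) (hm : m ≤ S) (hhdl : hdl ≤ S) (hf : fuel ≤ S) (h2k : 2 ^ kk ≤ S) :
    cMain L kk th Nf m hdl fuel ≤ S ^ 53 := by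
  have hS2 : 2 ≤ S := by omega
  unfold cMain
  exact (pw_add hS2 (pw_add hS2 (pw_add hS2 (pw_add hS2 (pw_add hS2 (pw_add hS2 (pw_add hS2 (pw_mul
    (pw_atom (by omega : 9 ≤ S)) (pw_atom hL)) (pw_atom (by omega : 8 ≤ S))) (cNorm_le hS hL hk
    hm h2k)) (pw_add hS2 (pw_add hS2 (pw_add hS2 (pw_mul (pw_atom (by omega : 2 ≤ S)) (pw_atom
    hm)) (pw_mul (pw_atom (by omega : 2 ≤ S)) (pw_add hS2 (pw_mul (pw_add hS2 (pw_mul (pw_add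
    hS2 (pw_atom hL) (pw_atom (by omega : 1 ≤ S))) (pw_atom hk)) (pw_atom (by omega : 2 ≤ S)))
    (pw_atom hm)) (pw_atom (by omega : 2 ≤ S))))) (pw_add hS2 (pw_mul (pw_atom hf) (pw_add hS2
    (cNode_le hS hL hk hNf hth hhdl h2k (pw_mul (pw_add hS2 (pw_atom (by omega : 1 ≤ S))
    (pw_atom hf)) (pw_add hS2 (pw_mul (pw_add hS2 (pw_mul (pw_add hS2 (pw_atom hL) (pw_atom (by
    omega : 1 ≤ S))) (pw_atom hk)) (pw_atom (by omega : 2 ≤ S))) (pw_atom hNf)) (pw_atom (by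
    omega : 1 ≤ S))))) (pw_atom (by omega : 2 ≤ S)))) (pw_atom (by omega : 1 ≤ S)))) (pw_atom
    (by omega : 5 ≤ S)))) (pw_mul (pw_atom (by omega : 3 ≤ S)) (pw_mul (pw_atom hf) (pw_add hS2
    (pw_add hS2 (pw_atom hhdl) (pw_mul (pw_add hS2 (pw_mul (pw_add hS2 (pw_atom hL) (pw_atom (by
    omega : 1 ≤ S))) (pw_atom hk)) (pw_atom (by omega : 2 ≤ S))) (pw_atom hNf))) (pw_atom (by
    omega : 1 ≤ S)))))) (pw_atom (by omega : 1 ≤ S))) (pw_mul (pw_atom (by omega : 2 ≤ S))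
    (pw_atom hhdl))) (pw_atom (by omega : 1 ≤ S)))

/-! ### Size invariants of the traversal -/

/-- The length of a member of a flat-map. [folklore] -/
theorem length_le_length_flatMap {α β : Type} (f : α → List β) {a : α} :
    ∀ {l : List α}, a ∈ l → (f a).length ≤ (l.flatMap f).length
  | [], h => absurd h List.not_mem_nil
  | b :: l, h => by
    rw [List.flatMap_cons, List.length_append]
    rcases List.mem_cons.1 h with rfl | h
    · omega
    · have := length_le_length_flatMap f h; omega

/-- Literals of a k-CNF are not longer than its encoding. [folklore] -/
theorem length_litBody_le_encode {k : ℕ} (φ : KCNF k) {c : List Lit} (hc : c ∈ φ.clauses) {l : Lit}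
    (hl : l ∈ c) : (litBody l).length ≤ φ.encode.length := by
  have h1 : (litBody l).length ≤ (KCNF.encodeLiteral l).length := by
    rw [encodeLiteral_eq]; simp
  have h2 : (KCNF.encodeLiteral l).length ≤ (cbody c).length := length_le_length_flatMap _ hl
  have h3 : (cbody c).length ≤ (KCNF.encodeClause c).length := by
    rw [encodeClause_eq]; simp; omega
  have h4 : (KCNF.encodeClause c).length ≤ (wFam φ.clauses).length := length_le_length_flatMap _ hc
  have h5 : (wFam φ.clauses).length ≤ φ.encode.length := by
    rw [encode_eq_hdr]; simp; omega
  omega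

/-- The header is not longer than the encoding. [folklore] -/
theorem length_hdrW_le_encode {k : ℕ} (φ : KCNF k) : (hdrW φ.numVars).length ≤ φ.encode.length := by
  rw [encode_eq_hdr, hdrW]; simp

/-- A literal set has at most as many elements as the clause has entries. [folklore] -/
theorem card_litSet_le {n : ℕ} : ∀ {c : List Lit}, IdxLt n c → (KCNF.litSet n c).card ≤ c.length
  | [], _ => by simp [KCNF.litSet]
  | l :: c, hc => by
    rw [litSet_cons l (hc l List.mem_cons_self), List.length_cons]
    exact (Finset.card_insert_le _ _).trans
      (Nat.succ_le_succ (card_litSet_le fun l' h => hc l' (List.mem_cons_of_mem _ h)))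

/-- All the literal sets below the clauses of a k-CNF: at most `m · 2^k` of them. [folklore] -/
def below {k : ℕ} (φ : KCNF k) : Finset (Finset (Fin φ.numVars × Bool)) :=
  (shF φ.numVars φ.clauses).biUnion Finset.powerset

/-- The number of literal sets below the clauses. [folklore] -/
theorem card_below_le {k : ℕ} (φ : KCNF k) : (below φ).card ≤ φ.clauses.length * 2 ^ k := by
  unfold below
  refine Finset.card_biUnion_le.trans ?_
  have h1 : ∀ s ∈ shF φ.numVars φ.clauses, s.powerset.card ≤ 2 ^ k := by
    intro s hs
    obtain ⟨c, hc, rfl⟩ := mem_shF.1 hs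
    rw [Finset.card_powerset]
    exact Nat.pow_le_pow_right (by norm_num)
      ((card_litSet_le (φ.fst_lt_numVars c hc)).trans (φ.length_le c hc))
  refine (Finset.sum_le_sum h1).trans ?_
  rw [Finset.sum_const, smul_eq_mul]
  refine Nat.mul_le_mul_right _ ?_
  rw [shF]; exact (List.toFinset_card_le _).trans (by simp)

/-- The good families of the traversal of `φ`: well-formed, made of sub-clauses of clauses of
`φ`, and of bounded length. [folklore] -/
def Good {k : ℕ} (φ : KCNF k) (F : List (List Lit)) : Prop :=
  WF φ.numVars k F ∧ (∀ c ∈ F, ∃ c₀ ∈ φ.clauses, c ⊆ c₀) ∧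
    F.length ≤ 2 * (φ.clauses.length * 2 ^ k) + 1

/-- `Θ` of a good family is short. [folklore] -/
theorem length_thetaL_le_of_good {k : ℕ} (φ : KCNF k) {F : List (List Lit)} (hF : Good φ F) :
    (thetaL F).length ≤ φ.clauses.length * 2 ^ k := by
  obtain ⟨hWF, hsub, -⟩ := hF
  have hnd := nodup_map_litSet_thetaL (n := φ.numVars) F hWF.idx
  rw [← List.length_map (f := KCNF.litSet φ.numVars), ← List.toFinset_card_of_nodup hnd]
  refine (Finset.card_le_card ?_).trans (card_below_le φ)
  intro s hs
  rw [List.mem_toFinset, List.mem_map] at hs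
  obtain ⟨c, hc, rfl⟩ := hs
  have hcF := mem_of_mem_thetaL hc
  obtain ⟨c₀, hc₀, hcc₀⟩ := hsub c hcF
  simp only [below, Finset.mem_biUnion, Finset.mem_powerset]
  exact ⟨_, mem_shF.2 ⟨c₀, hc₀, rfl⟩, (litSet_subset_iff (hWF.idx c hcF)).2 hcc₀⟩

/-- The root family is good. [folklore] -/
theorem good_root {k : ℕ} (φ : KCNF k) : Good φ (φ.clauses.map ddl) := by
  refine ⟨⟨?_, ?_, ?_⟩, ?_, ?_⟩
  · intro c hc l hl
    obtain ⟨c₀, hc₀, rfl⟩ := List.mem_map.1 hc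
    exact φ.fst_lt_numVars c₀ hc₀ l (mem_ddl_iff.1 hl)
  · intro c hc
    obtain ⟨c₀, hc₀, rfl⟩ := List.mem_map.1 hc
    exact nodup_ddl c₀
  · intro c hc
    obtain ⟨c₀, hc₀, rfl⟩ := List.mem_map.1 hc
    exact (length_ddl_le c₀).trans (φ.length_le c₀ hc₀)
  · intro c hc
    obtain ⟨c₀, hc₀, rfl⟩ := List.mem_map.1 hc
    exact ⟨c₀, hc₀, fun l hl => mem_ddl_iff.1 hl⟩
  · rw [List.length_map]
    have : 1 ≤ 2 ^ k := Nat.one_le_two_pow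
    nlinarith

/-- The size bounds of good families. [folklore] -/
theorem good_bounds {k : ℕ} (φ : KCNF k) {F : List (List Lit)} (hF : Good φ F) :
    (∀ c ∈ F, ∀ l ∈ c, (litBody l).length ≤ φ.encode.length) ∧ (∀ c ∈ F, c.length ≤ k) ∧
      F.length ≤ 2 * (φ.clauses.length * 2 ^ k) + 1 := by
  obtain ⟨hWF, hsub, hlen⟩ := hF
  refine ⟨fun c hc l hl => ?_, hWF.len, hlen⟩
  obtain ⟨c₀, hc₀, hcc₀⟩ := hsub c hc
  exact length_litBody_le_encode φ hc₀ (hcc₀ hl)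

/-- Children of good families are good. [folklore] -/
theorem good_nodeKids {k M₀ : ℕ} (hM₀ : 1 ≤ M₀) (φ : KCNF k) {F : List (List Lit)} (hF : Good φ F) :
    ∀ G ∈ nodeKids (Sparsification.theta M₀) k F, Good φ G := by
  have hθ1 : ∀ i, 1 ≤ Sparsification.theta M₀ i := one_le_theta hM₀
  intro G hG
  have hWG := hF.1.nodeKids hθ1 G hG
  have hT := length_thetaL_le_of_good φ hF
  obtain ⟨-, hsub, -⟩ := hF
  unfold Sparsifier.nodeKids at hG
  split at hG
  · rename_i j H hfb
    have hsubM : ∀ c ∈ thetaL F, ∃ c₀ ∈ φ.clauses, c ⊆ c₀ := fun c hc => hsub c (mem_of_mem_thetaL hc)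
    obtain ⟨pre, i, post, -, hfl, -⟩ := findBranch_eq_some hfb
    obtain ⟨s, hs, -, μ, -, rfl, -⟩ := findS_eq_some hfl
    have hHs : pick μ s ⊆ s := (pick_sublist μ s).subset
    simp only [List.mem_cons, List.not_mem_nil, or_false] at hG
    rcases hG with rfl | rfl
    · refine ⟨hWG, ?_, ?_⟩
      · intro c hc
        rw [List.mem_append, List.mem_singleton] at hc
        rcases hc with hc | rfl
        · exact hsubM c hc
        · obtain ⟨c₀, hc₀, hsc₀⟩ := hsubM s hs
          exact ⟨c₀, hc₀, List.Subset.trans hHs hsc₀⟩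
      · rw [List.length_append, List.length_singleton]; omega
    · refine ⟨hWG, ?_, ?_⟩
      · intro c hc
        rw [List.mem_append] at hc
        rcases hc with hc | hc
        · exact hsubM c hc
        · simp only [petalsL, List.mem_map, List.mem_filter] at hc
          obtain ⟨t, ⟨ht, -⟩, rfl⟩ := hc
          obtain ⟨c₀, hc₀, htc₀⟩ := hsubM t ht
          exact ⟨c₀, hc₀, List.Subset.trans (List.filter_sublist.subset) htc₀⟩
      · rw [List.length_append]
        have := length_petalsL_le' j (pick μ s) (thetaL F)
        omega
  · simp at hG

/-! ### The output formulas -/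

/-- A leaf family read as a k-CNF on `n` variables. [folklore] -/
def leafKCNF (k n : ℕ) (Ml : List (List Lit)) (h : WF n k Ml) : KCNF k :=
  ⟨n, Ml, fun c hc l hl => h.idx c hc l hl, h.len⟩

/-- Encoding of a leaf formula: header and family word. [folklore] -/
theorem encode_leafKCNF {k n : ℕ} (Ml : List (List Lit)) (h : WF n k Ml) :
    (leafKCNF k n Ml h).encode = hdrW n ++ wFam Ml := by
  rw [encode_eq_hdr, hdrW]; simp [leafKCNF]

/-- Semantics of a leaf formula. [folklore] -/
theorem eval_leafKCNF {k n : ℕ} (Ml : List (List Lit)) (h : WF n k Ml) (v : ℕ → Bool) :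
    (leafKCNF k n Ml h).eval v = true ↔ Covers (KCNF.trueLits n v) (shF n Ml) :=
  KCNF.eval_iff_covers _ v

/-- Leaves of the model tree are well-formed. [folklore] -/
theorem wf_of_mem_treeL {n k : ℕ} {θ : ℕ → ℕ} (hθ : ∀ i, 1 ≤ θ i) {f : ℕ} {F₀ : List (List Lit)}
    (h0 : WF n k F₀) {Ml : List (List Lit)} (h : Ml ∈ treeL θ k f F₀) : WF n k Ml := by
  obtain ⟨G, hG, rfl⟩ := exists_of_mem_treeL hθ f h0 Ml h
  exact hG.thetaL

/-- `ddl c` is empty iff `c` is. [folklore] -/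
theorem ddl_eq_nil_iff (c : List Lit) : ddl c = [] ↔ c = [] := by
  constructor
  · intro h
    cases c with
    | nil => rfl
    | cons l c =>
      have : l ∈ ddl (l :: c) := mem_ddl_iff.2 List.mem_cons_self
      rw [h] at this; exact absurd this List.not_mem_nil
  · rintro rfl; rfl

/-- The shadow ignores repetitions inside clauses. [folklore] -/
theorem shF_map_ddl (n : ℕ) (Cl : List (List Lit)) : shF n (Cl.map ddl) = shF n Cl := by
  unfold shF
  rw [List.map_map]
  congr 1
  refine List.map_congr_left fun c _ => ?_
  ext a
  simp [mem_litSet_iff, mem_ddl_iff]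

/-- A k-CNF with an empty clause is unsatisfiable. [folklore] -/
theorem eval_eq_false_of_nil_mem {k : ℕ} (φ : KCNF k) (h : [] ∈ φ.clauses) (v : ℕ → Bool) :
    φ.eval v = false := by
  rw [KCNF.eval, List.all_eq_false]
  exact ⟨[], h, by simp⟩

/-- Flat-map after a proof-carrying map whose values do not depend on the proofs. [folklore] -/
theorem flatMap_pmap_eq {α β γ : Type} {P : α → Prop} (f : ∀ a, P a → β) (g : β → List γ)
    (g' : α → List γ) (hg : ∀ a h, g (f a h) = g' a) :
    ∀ (l : List α) (H : ∀ a ∈ l, P a), (l.pmap f H).flatMap g = l.flatMap g'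
  | [], _ => rfl
  | a :: l, H => by
    rw [List.pmap, List.flatMap_cons, List.flatMap_cons, hg, flatMap_pmap_eq f g g' hg l]

/-- A family has at most as many clauses as its word has symbols. [folklore] -/
theorem length_le_length_wFam : ∀ F : List (List Lit), F.length ≤ (wFam F).length
  | [] => by simp
  | c :: F => by
    have := length_le_length_wFam F
    rw [wFam_cons]
    simp only [List.length_cons, List.length_append]
    omega

/-- A k-CNF has at most as many clauses as its encoding has symbols. [folklore] -/
theorem length_clauses_le_encode {k : ℕ} (φ : KCNF k) : φ.clauses.length ≤ φ.encode.length := by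
  refine (length_le_length_wFam φ.clauses).trans ?_
  rw [encode_eq_hdr]; simp; omega

/-- **The step count against the time bound**: with all size parameters bounded by the input
length `L`, the number of iterations `fuel + 1 ≤ 2 · 2^{(ε/108) · 2n}`, and the constants of `k`
and the thresholds, `cMain + 1 ≤ c · 2^{εn} · (L + 1)^c` for
`c = 4^54 (2^{k+1} + th + 2^k + k + 65)^54 + 54`. [folklore] -/
theorem cMain_succ_le (k th : ℕ) (ε : ℝ) {L n m hdl fuel : ℕ} (hmL : m ≤ L) (hhdl : hdl ≤ L)
    (hΦr : ((fuel + 1 : ℕ) : ℝ) ≤ 2 * (2 : ℝ) ^ (ε / 108 * (2 * n : ℕ))) :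
    ((cMain L k th (2 * (m * 2 ^ k) + 1) m hdl fuel + 1 : ℕ) : ℝ) ≤
      ((4 ^ 54 * (2 ^ (k + 1) + 1 + (th + 64 + 2 ^ k + k)) ^ 54 + 54 : ℕ) : ℝ) * (2 : ℝ) ^ (ε * n) *
        ((L : ℝ) + 1) ^ (4 ^ 54 * (2 ^ (k + 1) + 1 + (th + 64 + 2 ^ k + k)) ^ 54 + 54) := by
  -- all size expressions become opaque atoms
  obtain ⟨A, hA⟩ : ∃ A, 2 ^ (k + 1) + 1 = A := ⟨_, rfl⟩
  obtain ⟨B, hB⟩ : ∃ B, th + 64 + 2 ^ k + k = B := ⟨_, rfl⟩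
  rw [hA, hB]
  obtain ⟨AB, hAB⟩ : ∃ AB, A + B = AB := ⟨_, rfl⟩
  rw [hAB]
  obtain ⟨Φ, hΦ⟩ : ∃ Φ, fuel + 1 = Φ := ⟨_, rfl⟩
  rw [hΦ] at hΦr
  obtain ⟨S, hS⟩ : ∃ S, A * (L + 1) + B + Φ = S := ⟨_, rfl⟩
  have h2k1 : 2 ^ (k + 1) = 2 * 2 ^ k := by ring
  have hA1 : 3 ≤ A := by
    have := Nat.one_le_two_pow (n := k + 1); omega
  have hB64 : 64 ≤ B := by omega
  have hΦ1 : 1 ≤ Φ := by omega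
  have hAL : L + 1 ≤ A * (L + 1) := Nat.le_mul_of_pos_left _ (by omega)
  have hS64 : 64 ≤ S := by omega
  have hLS : L ≤ S := by omega
  have hkS : k ≤ S := by omega
  have hthS : th ≤ S := by omega
  have h2kS : 2 ^ k ≤ S := by omega
  have hmS : m ≤ S := by omega
  have hhdlS : hdl ≤ S := by omega
  have hfS : fuel ≤ S := by omega
  have hNfA : 2 * (m * 2 ^ k) + 1 ≤ A * (L + 1) := by
    rw [← hA, h2k1]
    have : m * 2 ^ k ≤ L * 2 ^ k := Nat.mul_le_mul_right _ hmL
    nlinarith [Nat.one_le_two_pow (n := k)]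
  have hNfS : 2 * (m * 2 ^ k) + 1 ≤ S := by omega
  have hcost : cMain L k th (2 * (m * 2 ^ k) + 1) m hdl fuel ≤ S ^ 53 :=
    cMain_le hS64 hLS hkS hthS hNfS hmS hhdlS hfS h2kS
  have hcost1 : cMain L k th (2 * (m * 2 ^ k) + 1) m hdl fuel + 1 ≤ S ^ 54 := by
    have h1 : 1 ≤ S ^ 53 := Nat.one_le_pow _ _ (by omega)
    calc cMain L k th (2 * (m * 2 ^ k) + 1) m hdl fuel + 1 ≤ S ^ 53 + S ^ 53 :=
          Nat.add_le_add hcost h1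
      _ = S ^ 53 * 2 := (Nat.mul_two _).symm
      _ ≤ S ^ 53 * S := Nat.mul_le_mul_left _ (by omega)
      _ = S ^ 54 := (pow_succ S 53).symm
  have hpowΦ : (Φ : ℝ) ^ 54 ≤ (2 : ℝ) ^ 54 * (2 : ℝ) ^ (ε * n) := by
    have h0 : (0 : ℝ) ≤ Φ := Nat.cast_nonneg _
    calc (Φ : ℝ) ^ 54 ≤ (2 * (2 : ℝ) ^ (ε / 108 * (2 * n : ℕ))) ^ 54 :=
          pow_le_pow_left₀ h0 hΦr 54
      _ = (2 : ℝ) ^ 54 * ((2 : ℝ) ^ (ε / 108 * (2 * n : ℕ))) ^ (54 : ℕ) := by rw [mul_pow]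
      _ = (2 : ℝ) ^ 54 * (2 : ℝ) ^ (ε * n) := by
          congr 1
          rw [← Real.rpow_natCast, ← Real.rpow_mul (by norm_num)]
          congr 1
          push_cast; ring
  have hSXΦ : S ≤ 2 * (AB * (L + 1)) * Φ := by
    rw [← hS, ← hAB]
    have hX1 : 1 ≤ A * (L + 1) + B := by omega
    have hXAB : A * (L + 1) + B ≤ (A + B) * (L + 1) := by nlinarith
    nlinarith
  have hSr : (S : ℝ) ≤ 2 * ((AB : ℝ) * ((L : ℝ) + 1)) * (Φ : ℝ) := by
    have h := (Nat.cast_le (α := ℝ)).2 hSXΦ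
    simp only [Nat.cast_mul, Nat.cast_add, Nat.cast_ofNat, Nat.cast_one] at h
    exact h
  have hc1 : ((4 : ℝ) ^ 54 * (AB : ℝ) ^ 54) ≤ ((4 ^ 54 * AB ^ 54 + 54 : ℕ) : ℝ) := by
    push_cast; linarith
  have hc54 : (54 : ℕ) ≤ 4 ^ 54 * AB ^ 54 + 54 := Nat.le_add_left _ _
  have hL1 : (1 : ℝ) ≤ (L : ℝ) + 1 := by linarith [(Nat.cast_nonneg L : (0 : ℝ) ≤ L)]
  have hLc : ((L : ℝ) + 1) ^ (54 : ℕ) ≤ ((L : ℝ) + 1) ^ (4 ^ 54 * AB ^ 54 + 54) :=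
    pow_le_pow_right₀ hL1 hc54
  have hcost1r : ((cMain L k th (2 * (m * 2 ^ k) + 1) m hdl fuel + 1 : ℕ) : ℝ) ≤ (S : ℝ) ^ 54 := by
    exact_mod_cast hcost1
  -- atoms for `ring`: `Z = AB`, `Y = L + 1`, `E = 2^{εn}`, `cc` the constant
  generalize hcc : (4 ^ 54 * AB ^ 54 + 54 : ℕ) = cc at hc1 hLc ⊢
  generalize hZ : (AB : ℝ) = Z at hSr hc1
  generalize hY : (L : ℝ) + 1 = Y at hSr hLc hL1
  generalize hE : (2 : ℝ) ^ (ε * n) = E at hpowΦ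
  have hZ0 : 0 ≤ Z := by rw [← hZ]; positivity
  have hY0 : 0 ≤ Y := by linarith
  have hE0 : 0 ≤ E := by rw [← hE]; positivity
  have hΦ0 : (0 : ℝ) ≤ Φ := Nat.cast_nonneg _
  have hS0 : (0 : ℝ) ≤ S := Nat.cast_nonneg _
  calc ((cMain L k th (2 * (m * 2 ^ k) + 1) m hdl fuel + 1 : ℕ) : ℝ) ≤ (S : ℝ) ^ 54 := hcost1r
    _ ≤ (2 * (Z * Y) * (Φ : ℝ)) ^ 54 := pow_le_pow_left₀ hS0 hSr 54
    _ = (2 : ℝ) ^ 54 * Z ^ 54 * Y ^ 54 * (Φ : ℝ) ^ 54 := by ring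
    _ ≤ (2 : ℝ) ^ 54 * Z ^ 54 * Y ^ 54 * ((2 : ℝ) ^ 54 * E) :=
        mul_le_mul_of_nonneg_left hpowΦ
          (mul_nonneg (mul_nonneg (pow_nonneg zero_le_two _) (pow_nonneg hZ0 _)) (pow_nonneg hY0 _))
    _ = ((4 : ℝ) ^ 54 * Z ^ 54) * E * Y ^ 54 := by ring
    _ ≤ (cc : ℝ) * E * Y ^ cc :=
        mul_le_mul (mul_le_mul_of_nonneg_right hc1 hE0) hLc (pow_nonneg hY0 _)
          (mul_nonneg (Nat.cast_nonneg _) hE0)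

end Sparsifier

/-! ### The data of the named fact, formula by formula -/

namespace Sparsifier

/-- The normalised root family of a k-CNF. [folklore] -/
def rootF {k : ℕ} (φ : KCNF k) : List (List Lit) := φ.clauses.map ddl

/-- The fuel of the abstract recursion: more than the number of families of literal sets.
[folklore] -/
def fuelA {k : ℕ} (φ : KCNF k) : ℕ := 2 ^ (2 * φ.numVars) + 1

/-- The leaves of the model tree of a k-CNF, for the thresholds `θ_i = Sparsification.theta M₀ i`.
[cite: ImpagliazzoPaturiZaneJCSS2001, §2 (Reduce)] -/
def leavesOf (M₀ k : ℕ) (φ : KCNF k) : List (List (List Lit)) :=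
  treeL (Sparsification.theta M₀) k (fuelA φ) (rootF φ)

/-- The root family is well-formed. [folklore] -/
theorem wf_rootF {k : ℕ} (φ : KCNF k) : WF φ.numVars k (rootF φ) := (good_root φ).1

/-- The root family has the empty clause iff the formula has. [folklore] -/
theorem nil_mem_rootF_iff {k : ℕ} (φ : KCNF k) : [] ∈ rootF φ ↔ [] ∈ φ.clauses := by
  unfold rootF
  rw [List.mem_map]
  constructor
  · rintro ⟨c, hc, e⟩; exact (ddl_eq_nil_iff c).1 e ▸ hc
  · intro h; exact ⟨[], h, rfl⟩

/-- **The output formulas** `F φ`: nothing if `φ` has the empty clause, otherwise the leaf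
families read as k-CNFs on the variables of `φ`.
[cite: ImpagliazzoPaturiZaneJCSS2001, Corollary 1 (the formulas of the disjunction)] -/
noncomputable def outF (M₀ k : ℕ) (hM₀ : 1 ≤ M₀) (φ : KCNF k) : List (KCNF k) :=
  if [] ∈ φ.clauses then [] else
    (leavesOf M₀ k φ).pmap (leafKCNF k φ.numVars) fun _ hMl =>
      wf_of_mem_treeL (Sparsification.one_le_theta hM₀) (wf_rootF φ) hMl

/-- The number of iterations of the main loop on `φ`. [folklore] -/
noncomputable def fuelOf (M₀ k : ℕ) (φ : KCNF k) : ℕ :=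
  if [] ∈ φ.clauses then 0 else tnodes (Sparsification.theta M₀) k (fuelA φ) (rootF φ)

/-- The sum of the thresholds `θ_0 + ⋯ + θ_{k-1}` (it bounds each of them, and `2n` times it
bounds the number of clauses of a leaf). [folklore] -/
def thSum (M₀ k : ℕ) : ℕ := ∑ i ∈ Finset.range k, Sparsification.theta M₀ i

/-- Each threshold below `k` is at most their sum. [folklore] -/
theorem theta_le_thSum (M₀ k : ℕ) {i : ℕ} (hi : i < k) : Sparsification.theta M₀ i ≤ thSum M₀ k :=
  Finset.single_le_sum (f := Sparsification.theta M₀) (fun _ _ => Nat.zero_le _)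
    (Finset.mem_range.2 hi)

/-- The step count of the program on `φ`, by the cost model. [folklore] -/
noncomputable def costOf (M₀ k : ℕ) (φ : KCNF k) : ℕ :=
  cMain φ.encode.length k (thSum M₀ k) (2 * (φ.clauses.length * 2 ^ k) + 1) φ.clauses.length
    (hdrW φ.numVars).length (fuelOf M₀ k φ)

/-- The constant of the time bound. [folklore] -/
def cst (M₀ k : ℕ) : ℕ := 4 ^ 54 * (2 ^ (k + 1) + 1 + (thSum M₀ k + 64 + 2 ^ k + k)) ^ 54 + 54

/-- **The time bound** `T n L = ⌊c · 2^{εn} · (L + 1)^c⌋₊`. [folklore] -/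
noncomputable def Tb (M₀ k : ℕ) (ε : ℝ) (n L : ℕ) : ℕ :=
  ⌊(cst M₀ k : ℝ) * (2 : ℝ) ^ (ε * n) * ((L : ℝ) + 1) ^ cst M₀ k⌋₊

/-- The time bound is `O(2^{εn} poly(L))`. [folklore] -/
theorem isExpPolyBound_Tb (M₀ k : ℕ) (ε : ℝ) : IsExpPolyBound ε (Tb M₀ k ε) :=
  ⟨cst M₀ k, fun n L => Nat.floor_le (by unfold cst; positivity)⟩

/-- **The model of the leaves of `φ`** (from `treeL_spec`, with the numerical bound of
`Sparsification.exists_good_params`). [cite: ImpagliazzoPaturiZaneJCSS2001, §2 Theorem 1 (proof)] -/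
theorem leavesOf_spec {M₀ k : ℕ} (hM₀ : 1 ≤ M₀) {y : ℝ} (hy : 1 ≤ y) {δ : ℝ}
    (hnum : ∀ n : ℕ, (1 + 1 / y) ^ (abnd M₀ k * n) * y ^ (k * (n / M₀)) ≤ (2 : ℝ) ^ (δ * n))
    (φ : KCNF k) (hne : [] ∉ φ.clauses) :
    TermL (Sparsification.theta M₀) k (fuelA φ) (rootF φ) ∧
    (((leavesOf M₀ k φ).length : ℝ) ≤ (2 : ℝ) ^ (δ * (2 * φ.numVars : ℕ))) ∧
    (∀ Ml ∈ leavesOf M₀ k φ, WF φ.numVars k Ml ∧ Ml.length ≤ thSum M₀ k * (2 * φ.numVars)) ∧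
    (∀ X, Covers X (shF φ.numVars (rootF φ)) ↔
      ∃ Ml ∈ leavesOf M₀ k φ, Covers X (shF φ.numVars Ml)) := by
  obtain ⟨h1, h2, h3, h4⟩ := treeL_spec hM₀ hy (wf_rootF φ) ((nil_mem_rootF_iff φ).not.2 hne)
  exact ⟨h1, h2.trans (hnum _), h3, h4⟩

/-- **The number of output formulas.** [cite: ImpagliazzoPaturiZaneJCSS2001, Corollary 1 (t ≤ 2^{εn})] -/
theorem length_outF_le {M₀ k : ℕ} (hM₀ : 1 ≤ M₀) {y : ℝ} (hy : 1 ≤ y) {ε : ℝ} (hε : 0 < ε)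
    (hnum : ∀ n : ℕ, (1 + 1 / y) ^ (abnd M₀ k * n) * y ^ (k * (n / M₀)) ≤ (2 : ℝ) ^ (ε / 108 * n))
    (φ : KCNF k) : ((outF M₀ k hM₀ φ).length : ℝ) ≤ (2 : ℝ) ^ (ε * φ.numVars) := by
  unfold outF
  by_cases hne : [] ∈ φ.clauses
  · rw [if_pos hne, List.length_nil, Nat.cast_zero]; positivity
  · rw [if_neg hne, List.length_pmap]
    refine (leavesOf_spec hM₀ hy hnum φ hne).2.1.trans
      (Real.rpow_le_rpow_of_exponent_le (by norm_num) ?_)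
    push_cast
    nlinarith [hε.le, (Nat.cast_nonneg φ.numVars : (0 : ℝ) ≤ φ.numVars)]

/-- **The output formulas are on the same variables and sparse.**
[cite: ImpagliazzoPaturiZaneJCSS2001, Corollary 1 (each with at most C·n clauses)] -/
theorem mem_outF {M₀ k : ℕ} (hM₀ : 1 ≤ M₀) {y : ℝ} (hy : 1 ≤ y) {δ : ℝ}
    (hnum : ∀ n : ℕ, (1 + 1 / y) ^ (abnd M₀ k * n) * y ^ (k * (n / M₀)) ≤ (2 : ℝ) ^ (δ * n))
    (φ : KCNF k) {ψ : KCNF k} (hψ : ψ ∈ outF M₀ k hM₀ φ) :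
    ψ.numVars = φ.numVars ∧ ψ.clauses.length ≤ 2 * thSum M₀ k * φ.numVars := by
  unfold outF at hψ
  by_cases hne : [] ∈ φ.clauses
  · rw [if_pos hne] at hψ; exact absurd hψ List.not_mem_nil
  · rw [if_neg hne] at hψ
    obtain ⟨Ml, hMl, rfl⟩ := List.mem_pmap.1 hψ
    refine ⟨rfl, ?_⟩
    have := ((leavesOf_spec hM₀ hy hnum φ hne).2.2.1 Ml hMl).2
    show Ml.length ≤ 2 * thSum M₀ k * φ.numVars
    linarith

/-- **The disjunction of the output formulas is equivalent to `φ`.**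
[cite: ImpagliazzoPaturiZaneJCSS2001, Corollary 1 (⋁ F_i ≡ φ), via Lemma 1] -/
theorem eval_iff_exists_outF {M₀ k : ℕ} (hM₀ : 1 ≤ M₀) {y : ℝ} (hy : 1 ≤ y) {δ : ℝ}
    (hnum : ∀ n : ℕ, (1 + 1 / y) ^ (abnd M₀ k * n) * y ^ (k * (n / M₀)) ≤ (2 : ℝ) ^ (δ * n))
    (φ : KCNF k) (v : ℕ → Bool) :
    φ.eval v = true ↔ ∃ ψ ∈ outF M₀ k hM₀ φ, ψ.eval v = true := by
  unfold outF
  by_cases hne : [] ∈ φ.clauses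
  · rw [if_pos hne, eval_eq_false_of_nil_mem φ hne v]
    simp
  · rw [if_neg hne, KCNF.eval_iff_covers, family_eq_shF, ← shF_map_ddl,
      show φ.clauses.map ddl = rootF φ from rfl, (leavesOf_spec hM₀ hy hnum φ hne).2.2.2]
    constructor
    · rintro ⟨Ml, hMl, hX⟩
      exact ⟨_, List.mem_pmap.2 ⟨Ml, hMl, rfl⟩, (eval_leafKCNF Ml _ v).2 hX⟩
    · rintro ⟨ψ, hψ, hv⟩
      obtain ⟨Ml, hMl, rfl⟩ := List.mem_pmap.1 hψ
      exact ⟨Ml, hMl, (eval_leafKCNF Ml _ v).1 hv⟩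

/-- The program's output word is the encoding of the output formulas. [folklore] -/
theorem progOut_eq_encodeList {M₀ k : ℕ} (hM₀ : 1 ≤ M₀) {y : ℝ} (hy : 1 ≤ y) {δ : ℝ}
    (hnum : ∀ n : ℕ, (1 + 1 / y) ^ (abnd M₀ k * n) * y ^ (k * (n / M₀)) ≤ (2 : ℝ) ^ (δ * n))
    (φ : KCNF k) :
    progOut (Sparsification.theta M₀) k (fuelOf M₀ k φ) φ = KCNF.encodeList (outF M₀ k hM₀ φ) := by
  unfold progOut outF fuelOf
  by_cases hne : [] ∈ φ.clauses
  · simp [if_pos hne, KCNF.encodeList]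
  · rw [if_neg hne, if_neg hne, if_neg hne]
    obtain ⟨e, -⟩ := dfsOut_cons_eq (Sparsification.theta M₀) k (hdrW φ.numVars) (fuelA φ) (rootF φ)
      (leavesOf_spec hM₀ hy hnum φ hne).1 _ [] le_rfl
    rw [show φ.clauses.map ddl = rootF φ from rfl, e, Nat.sub_self, dfsOut_nil, List.append_nil,
      encodeList_eq, flatMap_pmap_eq _ _ (fun Ml => hdrW φ.numVars ++ wFam Ml ++ [Γ'.blank])
        (fun Ml h => rfl)]
    rfl

/-- The traversal ends within the fuel. [folklore] -/
theorem dfsDone_fuelOf {M₀ k : ℕ} (hM₀ : 1 ≤ M₀) {y : ℝ} (hy : 1 ≤ y) {δ : ℝ}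
    (hnum : ∀ n : ℕ, (1 + 1 / y) ^ (abnd M₀ k * n) * y ^ (k * (n / M₀)) ≤ (2 : ℝ) ^ (δ * n))
    (φ : KCNF k) (hne : [] ∉ φ.clauses) :
    DfsDone (Sparsification.theta M₀) k (fuelOf M₀ k φ) [φ.clauses.map ddl] := by
  unfold fuelOf
  rw [if_neg hne]
  obtain ⟨-, d⟩ := dfsOut_cons_eq (Sparsification.theta M₀) k (hdrW φ.numVars) (fuelA φ) (rootF φ)
    (leavesOf_spec hM₀ hy hnum φ hne).1 _ [] le_rfl
  rw [show φ.clauses.map ddl = rootF φ from rfl, d, Nat.sub_self]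
  exact dfsDone_nil _ k 0

open Complexity in
/-- **The program computes the output formulas within the cost model.**
[cite: ImpagliazzoPaturiZaneJCSS2001, Corollary 1 (the algorithm), via `Sparsifier.runs_main`] -/
theorem runs_main_outF {M₀ k : ℕ} (hM₀ : 1 ≤ M₀) {y : ℝ} (hy : 1 ≤ y) {δ : ℝ}
    (hnum : ∀ n : ℕ, (1 + 1 / y) ^ (abnd M₀ k * n) * y ^ (k * (n / M₀)) ≤ (2 : ℝ) ^ (δ * n))
    (φ : KCNF k) :
    ACom.Runs (main (Sparsification.theta M₀) k) (AStore.single K.inp φ.encode)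
      (AStore.single K.out (KCNF.encodeList (outF M₀ k hM₀ φ))) (costOf M₀ k φ) := by
  rw [← progOut_eq_encodeList hM₀ hy hnum φ]
  exact runs_main (Sparsification.theta M₀) k φ φ.encode.length k (thSum M₀ k)
    (2 * (φ.clauses.length * 2 ^ k) + 1) (fuelOf M₀ k φ) le_rfl (fun i hi => theta_le_thSum M₀ k hi)
    le_rfl (fun c hc l hl => length_litBody_le_encode φ hc hl) φ.length_le (Good φ)
    (fun G hG => good_bounds φ hG) (fun G hG => good_nodeKids hM₀ φ hG) (good_root φ)
    (dfsDone_fuelOf hM₀ hy hnum φ)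

/-- The number of iterations against the number of leaves. [folklore] -/
theorem fuelOf_succ_le {M₀ k : ℕ} (hM₀ : 1 ≤ M₀) {y : ℝ} (hy : 1 ≤ y) {δ : ℝ}
    (hnum : ∀ n : ℕ, (1 + 1 / y) ^ (abnd M₀ k * n) * y ^ (k * (n / M₀)) ≤ (2 : ℝ) ^ (δ * n))
    (φ : KCNF k) :
    ((fuelOf M₀ k φ + 1 : ℕ) : ℝ) ≤ 2 * (2 : ℝ) ^ (δ * (2 * φ.numVars : ℕ)) := by
  have h1 : (1 : ℝ) ≤ (2 : ℝ) ^ (δ * (2 * φ.numVars : ℕ)) := by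
    have := hnum (2 * φ.numVars)
    refine le_trans ?_ this
    exact one_le_mul_of_one_le_of_one_le (one_le_pow₀ (by
      have : (0 : ℝ) ≤ 1 / y := by positivity
      linarith)) (one_le_pow₀ hy)
  unfold fuelOf
  by_cases hne : [] ∈ φ.clauses
  · rw [if_pos hne, Nat.zero_add, Nat.cast_one]; linarith
  · rw [if_neg hne]
    have ht := tnodes_le (Sparsification.theta M₀) k (fuelA φ) (rootF φ)
    have hlen := (leavesOf_spec hM₀ hy hnum φ hne).2.1
    calc ((tnodes (Sparsification.theta M₀) k (fuelA φ) (rootF φ) + 1 : ℕ) : ℝ)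
        ≤ ((2 * (leavesOf M₀ k φ).length : ℕ) : ℝ) := by exact_mod_cast ht
      _ = 2 * ((leavesOf M₀ k φ).length : ℝ) := by push_cast; ring
      _ ≤ 2 * (2 : ℝ) ^ (δ * (2 * φ.numVars : ℕ)) := by linarith

/-- **The step count is within the time bound.** [folklore] -/
theorem costOf_succ_le_Tb {M₀ k : ℕ} (hM₀ : 1 ≤ M₀) {y : ℝ} (hy : 1 ≤ y) {ε : ℝ}
    (hnum : ∀ n : ℕ, (1 + 1 / y) ^ (abnd M₀ k * n) * y ^ (k * (n / M₀)) ≤ (2 : ℝ) ^ (ε / 108 * n))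
    (φ : KCNF k) : costOf M₀ k φ + 1 ≤ Tb M₀ k ε φ.numVars φ.encode.length := by
  refine Nat.le_floor ?_
  exact cMain_succ_le k (thSum M₀ k) ε (length_clauses_le_encode φ) (length_hdrW_le_encode φ)
    (fuelOf_succ_le hM₀ hy hnum φ)

end Sparsifier

/-! ### The named fact, proved -/

open Sparsifier Complexity in
/-- **fine-grained.S05, proved.** The sparsification lemma with its time bound
(`Literature.Computability.FineGrained.sparsification`: Impagliazzo–Paturi–Zane, JCSS 63 (2001), Theorem 1 and
Corollary 1): for all `k` and `ε > 0` there are `C`, a function `F` and a time bound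
`T = O(2^{εn} poly(L))` such that `F φ` is a list of at most `2^{εn}` k-CNFs on the variables of
`φ`, each with at most `C · n` clauses, whose disjunction is equivalent to `φ`, and `F` is computed
by a multi-stack Turing machine within `T`. Here `F φ` lists the leaves of the recursion tree of
`Reduce` (run with the parameters of `Sparsification.exists_good_params k (ε/108)` on the
literal sets of the clauses), the machine is the compiled stack program `Sparsifier.main`, and
`T n L = ⌊c · 2^{εn} · (L + 1)^c⌋₊`.
[cite: ImpagliazzoPaturiZaneJCSS2001, Theorem 1 and Corollary 1] -/
theorem sparsification_holds : sparsification := by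
  intro k ε hε
  have hε' : 0 < ε / 108 := by positivity
  obtain ⟨M₀, hM₀2, y, hy, hnum⟩ := Sparsification.exists_good_params k hε'
  have hM₀ : 1 ≤ M₀ := by omega
  obtain ⟨Mach, hMach⟩ := ACom.exists_computesInTime (main (Sparsification.theta M₀) k) K.inp K.out
    KCNF.encode KCNF.encodeList (outF M₀ k hM₀) (costOf M₀ k) (runs_main_outF hM₀ hy hnum)
  refine ⟨2 * thSum M₀ k, outF M₀ k hM₀, Tb M₀ k ε, fun φ => ⟨length_outF_le hM₀ hy hε hnum φ,
    fun ψ hψ => mem_outF hM₀ hy hnum φ hψ, eval_iff_exists_outF hM₀ hy hnum φ⟩,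
    isExpPolyBound_Tb M₀ k ε, Mach, fun φ => (hMach φ).mono (costOf_succ_le_Tb hM₀ hy hnum φ)⟩

end Literature.Computability.FineGrained
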